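import Literature.Analysis.FluidPDE.LocalLerayDifferenceRHS
import HarnessLib

/-!
# The transport estimates in the proof of Lemarié-Rieusset 2016, Thm. 14.7, proved; U₁ and U
from the tested inequality and the pressure estimates alone

Analysis/FluidPDE proof file (theorems only) on the decomposition path of the named fact
`Literature.Analysis.FluidPDE.local_leray_weak_strong_uniqueness` (**U**; P. G. Lemarié-Rieusset,
*The Navier–Stokes Problem in the 21st Century* (2016), Thm. 14.7). The reduction of
`LocalLerayDifferenceRHS.lean` (`local_leray_difference_energy_estimate_of_pressure_transport`)
left three inline hypotheses below **U₁**: the tested local energy inequality for the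
difference (part 1, pp. 515–516), the pressure estimates (pp. 516–517), and the three
*transport estimates* of p. 517 ("`∫₀ᵗ∫(w·∇φ)(u₁·w) ≤ C∫₀ᵗ‖u₃‖_∞α² + C‖u₄‖γ(γ² + ∫₀ᵗα²)^{1/2}`",
"`∫₀ᵗ∫(u₁·∇φ)|w|²/2 ≤ C∫₀ᵗ‖u₃‖_∞α² + C‖u₄‖(γ² + ∫₀ᵗα²)`", "`-∫₀ᵗ∫φu₁·(w·∇w) ≤
Cγ(∫₀ᵗ‖u₃‖²_∞α²)^{1/2} + C‖u₄‖γ(γ² + ∫₀ᵗα²)^{1/2}`"). This file **proves the transport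
estimates** (`local_leray_difference_transport_estimates`) — Hölder / Sobolev-on-balls /
Cauchy–Schwarz bookkeeping with the splitting `u₁ = u₃ + u₄`, `|u₃(s)| ≤ m(s)`, `‖u₄‖_{L³} ≤ ε` —
and composes: `local_leray_difference_energy_estimate_of_energyIneq_pressure : (part 1) →
(pressure estimates) → U₁` and `local_leray_weak_strong_uniqueness_of_energyIneq_pressure :
(part 1) → (pressure estimates) → U`. After this file the unproved inputs of **U** are exactly
the two deep ones: the weak–strong tested energy inequality for the difference and the local
pressure estimates (Kang–Miura–Tsai 2021, Lemma 3.4, plus Calderón–Zygmund).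

Ingredients, all proved here:

* `WeakStrongSetting.ae_slice` — for a.e. `s ∈ (0,T)`: the slices `u₁ s`, `u₂ s`, `u₃ s` are
  measurable, `u₁ s = u₃ s + u₄ s` a.e., `‖u₃ s‖ ≤ m(s)` a.e. (`enorm_ae_le_eLpNormEssSup`),
  `‖u₄ s‖_{L³} ≤ ε`, and `G₁ s - G₂ s` is a weak derivative of `u₁ s - u₂ s` (slices of weak
  spatial gradients, `HasWeakSpatialGradientOn.ae_hasWeakFDerivOn_slice`);
* `lintegral_mul_sq_le_L3_L6_L2` (and a private three-factor variant; the tree's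
  `lintegral_mul_mul_le_L3_L6_L2` of `TaoQuantitativeNonlinearEnergy.lean` is the same inequality,
  not imported here) — Hölder with the exponents `3`, `6`, `2` in `ℝ≥0∞`;
* `lintegral_ball_mul_sq_le_of_split`, `lintegral_ball_mul_frob_mul_le_of_split` — the spatial
  estimates on a ball `B(x₀,R)`: `∫_B|a||f|² ≤ m∫_B|f|² + εC_S(‖f‖₂ + ‖g‖₂)‖f‖₂` and
  `∫_B|a||g|_F|f| ≤ m‖g‖₂‖f‖₂ + εC_S(‖f‖₂ + ‖g‖₂)‖g‖₂` for `a = b + c`, `|b| ≤ m`, `‖c‖₃ ≤ ε`,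
  `‖f‖_{L⁶(B)} ≤ C_S(‖f‖_{L²(B)} + ‖g‖_{L²(B)})` (the centre-uniform Sobolev inequality
  `exists_eLpNorm_six_le_ball_uniform` of `SobolevSixBall.lean`);
* `WeakStrongSetting.ae_slice_ball_estimates`, `WeakStrongSetting.tonelli_data` — the good
  slices quantitatively, and Tonelli on the cylinders `(0,t) × B(x₀,R)`;
* `exists_cylinder_transport_bound`, `exists_cylinder_stretching_bound` — the time-integrated
  cylinder bounds `∫₀ᵗ∫_{B(x₀,R)}|u₁||w|² ≤ C(R)(∫₀ᵗmα² + ε(γ² + ∫₀ᵗα²))` and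
  `∫₀ᵗ∫_{B(x₀,R)}|u₁||∇w|_F|w| ≤ C(R)(γ(∫₀ᵗm²α²)^{1/2} + ε(γ² + ∫₀ᵗα²))` (coverings of
  `UnitBallCovering.lean`; `|m| = √(m²)` for the measurability of the majorant; `√(ab) ≤ a + b`).

## References

* P. G. Lemarié-Rieusset, *The Navier–Stokes Problem in the 21st Century*, CRC Press 2016,
  doi:10.1201/b19556 (held copy): proof of Thm. 14.7, file p. 517 (fourth, sixth and seventh
  estimates); pp. 515–516 (the remaining deep inputs). [LemarieRieusset2016]
* J. C. Robinson, J. L. Rodrigo, W. Sadowski, *The three-dimensional Navier–Stokes equations*,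
  CUP 2016, Thm. 1.7 (Sobolev on balls). [RobinsonRodrigoSadowski2016]
-/


noncomputable section

open MeasureTheory TopologicalSpace Set Function Filter Topology Metric
open scoped ENNReal NNReal RealInnerProductSpace

namespace Literature.Analysis.FluidPDE

/-! ## The a.e.-in-time slice data of the setting -/

namespace LemarieRieusset2016

variable {ν T : ℝ} {u₀ : (EuclideanSpace ℝ (Fin 3)) → (EuclideanSpace ℝ (Fin 3))}
  {u₁ u₂ : ℝ → (EuclideanSpace ℝ (Fin 3)) → (EuclideanSpace ℝ (Fin 3))}
  {p₁ p₂ : ℝ → (EuclideanSpace ℝ (Fin 3)) → ℝ}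
  {u₃ u₄ : ℝ → (EuclideanSpace ℝ (Fin 3)) → (EuclideanSpace ℝ (Fin 3))} {m : ℝ → ℝ} {ε : ℝ}
  {G₁ G₂ : ℝ → (EuclideanSpace ℝ (Fin 3)) → (EuclideanSpace ℝ (Fin 3)) →L[ℝ] (EuclideanSpace ℝ (Fin 3))}

/-- **The a.e. slice data of the weak–strong setting.** For a.e. `s ∈ (0,T)`: the slices
`u₁ s`, `u₂ s`, `u₃ s` are a.e.-strongly measurable; the splitting holds on the slice,
`u₁ s x = u₃ s x + u₄ s x` for a.e. `x`; `‖u₃ s x‖ ≤ m(s)` for a.e. `x`; `‖u₄ s‖_{L³} ≤ ε`; and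
`G₁ s - G₂ s` is a weak derivative of `u₁ s - u₂ s` on the whole space (Fubini on the strip;
`enorm_ae_le_eLpNormEssSup`; slices of weak spatial gradients). [folklore] -/
theorem WeakStrongSetting.ae_slice (hS : WeakStrongSetting ν T u₀ u₁ u₂ p₁ p₂ u₃ u₄ m ε G₁ G₂) :
    ∀ᵐ s ∂(volume.restrict (Ioo 0 T)),
      AEStronglyMeasurable (u₁ s) volume ∧ AEStronglyMeasurable (u₂ s) volume ∧
      AEStronglyMeasurable (u₃ s) volume ∧
      (∀ᵐ x ∂(volume : Measure (EuclideanSpace ℝ (Fin 3))), u₁ s x = u₃ s x + u₄ s x) ∧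
      (∀ᵐ x ∂(volume : Measure (EuclideanSpace ℝ (Fin 3))), ‖u₃ s x‖ₑ ≤ ENNReal.ofReal (m s)) ∧
      eLpNorm (u₄ s) 3 volume ≤ ENNReal.ofReal ε ∧
      FunctionSpaces.HasWeakFDerivOn (⊤ : Opens (EuclideanSpace ℝ (Fin 3))) volume
        (u₁ s - u₂ s) (G₁ s - G₂ s) := by
  have h₁ := hS.sol₁.ae_aestronglyMeasurable_slice
  have h₂ := hS.sol₂.ae_aestronglyMeasurable_slice
  have h₃ : ∀ᵐ s ∂(volume.restrict (Ioo 0 T)), AEStronglyMeasurable (u₃ s) volume := by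
    have hu := hS.measurable₃
    rw [volume_restrict_strip_eq_prod] at hu
    exact hu.prodMk_left
  have hsplit : ∀ᵐ s ∂(volume.restrict (Ioo 0 T)),
      ∀ᵐ x ∂(volume : Measure (EuclideanSpace ℝ (Fin 3))), u₁ s x = u₃ s x + u₄ s x := by
    have hs := hS.split
    rw [volume_restrict_strip_eq_prod] at hs
    exact Measure.ae_ae_of_ae_prod hs
  have hbd₃ : ∀ᵐ s ∂(volume.restrict (Ioo 0 T)),
      ∀ᵐ x ∂(volume : Measure (EuclideanSpace ℝ (Fin 3))), ‖u₃ s x‖ₑ ≤ ENNReal.ofReal (m s) := by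
    filter_upwards [hS.bound₃] with s hs
    filter_upwards [enorm_ae_le_eLpNormEssSup (u₃ s) volume] with x hx
    rw [← eLpNorm_exponent_top] at hx
    exact hx.trans hs
  have hgrad : ∀ᵐ s ∂(volume.restrict (Ioo 0 T)),
      FunctionSpaces.HasWeakFDerivOn (⊤ : Opens (EuclideanSpace ℝ (Fin 3))) volume
        (u₁ s - u₂ s) (G₁ s - G₂ s) := by
    have g₁ := hS.grad₁
    have g₂ := hS.grad₂
    rw [slab_eq_prod_top] at g₁ g₂
    filter_upwards [g₁.ae_hasWeakFDerivOn_slice, g₂.ae_hasWeakFDerivOn_slice] with s hs₁ hs₂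
    exact hs₁.sub hs₂
  filter_upwards [h₁, h₂, h₃, hsplit, hbd₃, hS.bound₄, hgrad] with s a b c d e f g
  exact ⟨a, b, c, d, e, f, g⟩

end LemarieRieusset2016

/-! ## Hölder with the exponents `3`, `6`, `2` -/

/-- **`∫ a f² ≤ ‖a‖₃ ‖f‖₆ ‖f‖₂`** for `ℝ≥0∞`-valued a.e.-measurable `a`, `f` (Hölder with the
exponents `3`, `3/2` on `a · f²`, then `4`, `4/3` on `f^{3/2} · f^{3/2}`), in lower-integral
form: `∫ a f² ≤ (∫ a³)^{1/3} (∫ f⁶)^{1/6} (∫ f²)^{1/2}`. [folklore] -/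
theorem lintegral_mul_sq_le_L3_L6_L2 {X : Type*} [MeasurableSpace X] (μ : Measure X)
    {a f : X → ℝ≥0∞} (ha : AEMeasurable a μ) (hf : AEMeasurable f μ) :
    ∫⁻ x, a x * f x ^ 2 ∂μ ≤
      (∫⁻ x, a x ^ (3 : ℝ) ∂μ) ^ (1 / 3 : ℝ) * (∫⁻ x, f x ^ (6 : ℝ) ∂μ) ^ (1 / 6 : ℝ) *
        (∫⁻ x, f x ^ (2 : ℝ) ∂μ) ^ (1 / 2 : ℝ) := by
  -- first Hölder: `∫ a f² ≤ ‖a‖₃ ‖f²‖_{3/2}`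
  have hpq : (3 : ℝ).HolderConjugate (3 / 2) := by
    have := Real.holderConjugate_one_div (a := 1 / 3) (b := 2 / 3) (by norm_num) (by norm_num)
      (by norm_num)
    norm_num at this
    exact this
  have h1 := ENNReal.lintegral_mul_le_Lp_mul_Lq μ hpq ha (hf.pow_const 2)
  -- second Hölder on `(f²)^{3/2} = f^{3/2} f^{3/2}`
  have hpq' : (4 : ℝ).HolderConjugate (4 / 3) := by
    have := Real.holderConjugate_one_div (a := 1 / 4) (b := 3 / 4) (by norm_num) (by norm_num)
      (by norm_num)
    norm_num at this
    exact this
  have h2 := ENNReal.lintegral_mul_le_Lp_mul_Lq μ hpq' (hf.pow_const (3 / 2 : ℝ))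
    (hf.pow_const (3 / 2 : ℝ))
  have e32 : ∀ x, (f x ^ 2) ^ (3 / 2 : ℝ) = f x ^ (3 / 2 : ℝ) * f x ^ (3 / 2 : ℝ) := fun x => by
    rw [← ENNReal.rpow_natCast, ← ENNReal.rpow_mul, ← ENNReal.rpow_add_of_nonneg _ _ (by norm_num)
      (by norm_num)]
    norm_num
  have e6 : ∀ x, (f x ^ (3 / 2 : ℝ)) ^ (4 : ℝ) = f x ^ (6 : ℝ) := fun x => by
    rw [← ENNReal.rpow_mul]; norm_num
  have e2 : ∀ x, (f x ^ (3 / 2 : ℝ)) ^ (4 / 3 : ℝ) = f x ^ (2 : ℝ) := fun x => by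
    rw [← ENNReal.rpow_mul]; norm_num
  simp only [Pi.mul_apply, e6, e2] at h2
  have h3 : (∫⁻ x, (f x ^ 2) ^ (3 / 2 : ℝ) ∂μ) ^ (1 / (3 / 2 : ℝ)) ≤
      (∫⁻ x, f x ^ (6 : ℝ) ∂μ) ^ (1 / 6 : ℝ) * (∫⁻ x, f x ^ (2 : ℝ) ∂μ) ^ (1 / 2 : ℝ) := by
    have e : ∫⁻ x, (f x ^ 2) ^ (3 / 2 : ℝ) ∂μ = ∫⁻ x, f x ^ (3 / 2 : ℝ) * f x ^ (3 / 2 : ℝ) ∂μ :=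
      lintegral_congr fun x => e32 x
    rw [e, show (1 : ℝ) / (3 / 2) = 2 / 3 by norm_num]
    calc (∫⁻ x, f x ^ (3 / 2 : ℝ) * f x ^ (3 / 2 : ℝ) ∂μ) ^ (2 / 3 : ℝ)
        ≤ ((∫⁻ x, f x ^ (6 : ℝ) ∂μ) ^ (1 / 4 : ℝ) * (∫⁻ x, f x ^ (2 : ℝ) ∂μ) ^ (1 / (4 / 3) : ℝ)) ^
            (2 / 3 : ℝ) := ENNReal.rpow_le_rpow h2 (by norm_num)
      _ = (∫⁻ x, f x ^ (6 : ℝ) ∂μ) ^ (1 / 6 : ℝ) * (∫⁻ x, f x ^ (2 : ℝ) ∂μ) ^ (1 / 2 : ℝ) := by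
          rw [ENNReal.mul_rpow_of_nonneg _ _ (by norm_num), ← ENNReal.rpow_mul, ← ENNReal.rpow_mul]
          norm_num
  calc ∫⁻ x, a x * f x ^ 2 ∂μ ≤ (∫⁻ x, a x ^ (3 : ℝ) ∂μ) ^ (1 / 3 : ℝ) *
        (∫⁻ x, (f x ^ 2) ^ (3 / 2 : ℝ) ∂μ) ^ (1 / (3 / 2 : ℝ)) := by
        simpa only [Pi.mul_apply] using h1
    _ ≤ (∫⁻ x, a x ^ (3 : ℝ) ∂μ) ^ (1 / 3 : ℝ) *
        ((∫⁻ x, f x ^ (6 : ℝ) ∂μ) ^ (1 / 6 : ℝ) * (∫⁻ x, f x ^ (2 : ℝ) ∂μ) ^ (1 / 2 : ℝ)) :=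
        mul_le_mul_right h3 _
    _ = _ := by ring

/-! ## The spatial estimate of a good slice on a ball -/

/-- **`∫_B |a||f|² ≤ m ∫_B|f|² + ε C_S (‖f‖_{L²(B)} + ‖g‖_{L²(B)}) ‖f‖_{L²(B)}` on a ball
`B = B(x₀,R)`**, for a field `a = b + c` (a.e.) with `|b| ≤ m` a.e. and `‖c‖_{L³} ≤ ε`, and `f`
with weak derivative `g` on `B` satisfying the Sobolev inequality
`‖f‖_{L⁶(B)} ≤ C_S(‖f‖_{L²(B)} + ‖g‖_{L²(B)})` (hypothesis `hSob`, supplied uniformly in the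
centre by `exists_eLpNorm_six_le_ball_uniform`): the `b`-part by monotonicity, the `c`-part by
Hölder with the exponents `3`, `6`, `2` (`lintegral_mul_sq_le_L3_L6_L2`). This is the spatial
half of the printed "`∫(w·∇φ)(u₁·w) ≤ C‖u₃‖_∞α² + C‖u₄‖_{𝒱̄¹}‖ψw‖_{H¹}α`" bookkeeping
(Lemarié-Rieusset 2016, p. 517). [folklore] -/
theorem lintegral_ball_mul_sq_le_of_split {a b c f : (EuclideanSpace ℝ (Fin 3)) → (EuclideanSpace ℝ (Fin 3))}
    {g : (EuclideanSpace ℝ (Fin 3)) → (EuclideanSpace ℝ (Fin 3)) →L[ℝ] (EuclideanSpace ℝ (Fin 3))}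
    {x₀ : EuclideanSpace ℝ (Fin 3)} {R mval ε : ℝ} {CS : ℝ≥0}
    (hb : AEStronglyMeasurable b volume) (hc : AEStronglyMeasurable c volume)
    (hf : AEStronglyMeasurable f (volume.restrict (ball x₀ R)))
    (habc : ∀ᵐ x ∂(volume : Measure (EuclideanSpace ℝ (Fin 3))), a x = b x + c x)
    (hbm : ∀ᵐ x ∂(volume : Measure (EuclideanSpace ℝ (Fin 3))), ‖b x‖ₑ ≤ ENNReal.ofReal mval)
    (hcε : eLpNorm c 3 volume ≤ ENNReal.ofReal ε)
    (hSob : eLpNorm f 6 (volume.restrict (ball x₀ R)) ≤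
      CS * (eLpNorm f 2 (volume.restrict (ball x₀ R)) +
        (∫⁻ x in ball x₀ R, ENNReal.ofReal (frobeniusNormSq (g x))) ^ (1 / 2 : ℝ))) :
    ∫⁻ x in ball x₀ R, ‖a x‖ₑ * ‖f x‖ₑ ^ 2 ≤
      ENNReal.ofReal mval * (∫⁻ x in ball x₀ R, ‖f x‖ₑ ^ 2) +
        ENNReal.ofReal ε * (CS * ((∫⁻ x in ball x₀ R, ‖f x‖ₑ ^ 2) ^ (1 / 2 : ℝ) +
          (∫⁻ x in ball x₀ R, ENNReal.ofReal (frobeniusNormSq (g x))) ^ (1 / 2 : ℝ))) *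
          (∫⁻ x in ball x₀ R, ‖f x‖ₑ ^ 2) ^ (1 / 2 : ℝ) := by
  set μ : Measure (EuclideanSpace ℝ (Fin 3)) := volume.restrict (ball x₀ R) with hμ
  set E : ℝ≥0∞ := ∫⁻ x, ‖f x‖ₑ ^ 2 ∂μ with hE
  set Gg : ℝ≥0∞ := ∫⁻ x, ENNReal.ofReal (frobeniusNormSq (g x)) ∂μ with hGg
  have hbμ : AEStronglyMeasurable b μ := hb.restrict
  have hcμ : AEStronglyMeasurable c μ := hc.restrict
  -- `E^{1/2} = ‖f‖_{L²(B)}`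
  have hE2 : eLpNorm f 2 μ = E ^ (1 / 2 : ℝ) := by
    rw [eLpNorm_eq_lintegral_rpow_enorm_toReal two_ne_zero ENNReal.ofNat_ne_top, ENNReal.toReal_ofNat, hE]
    congr 1
    exact lintegral_congr fun x => by rw [show (2 : ℝ) = ((2 : ℕ) : ℝ) by norm_num, ENNReal.rpow_natCast]
  -- splitting `|a| ≤ |b| + |c|`
  have hsplit : ∀ᵐ x ∂μ, ‖a x‖ₑ * ‖f x‖ₑ ^ 2 ≤ ‖b x‖ₑ * ‖f x‖ₑ ^ 2 + ‖c x‖ₑ * ‖f x‖ₑ ^ 2 := by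
    filter_upwards [ae_restrict_of_ae (s := ball x₀ R) habc] with x hx
    rw [hx, ← add_mul]
    exact mul_le_mul_left (enorm_add_le _ _) _
  -- the `b`-part
  have hbpart : ∫⁻ x, ‖b x‖ₑ * ‖f x‖ₑ ^ 2 ∂μ ≤ ENNReal.ofReal mval * E := by
    calc ∫⁻ x, ‖b x‖ₑ * ‖f x‖ₑ ^ 2 ∂μ ≤ ∫⁻ x, ENNReal.ofReal mval * ‖f x‖ₑ ^ 2 ∂μ :=
          lintegral_mono_ae ((ae_restrict_of_ae (s := ball x₀ R) hbm).mono fun x hx =>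
            mul_le_mul_left hx _)
      _ = ENNReal.ofReal mval * E := lintegral_const_mul' _ _ ENNReal.ofReal_ne_top
  -- the `c`-part: Hölder `3, 6, 2`
  have hH := lintegral_mul_sq_le_L3_L6_L2 μ hcμ.enorm hf.enorm
  have hc3 : (∫⁻ x, ‖c x‖ₑ ^ (3 : ℝ) ∂μ) ^ (1 / 3 : ℝ) ≤ ENNReal.ofReal ε := by
    have e : eLpNorm c 3 μ = (∫⁻ x, ‖c x‖ₑ ^ (3 : ℝ) ∂μ) ^ (1 / 3 : ℝ) := by
      rw [eLpNorm_eq_lintegral_rpow_enorm_toReal (by norm_num) ENNReal.ofNat_ne_top, ENNReal.toReal_ofNat]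
    rw [← e]
    exact (eLpNorm_mono_measure c Measure.restrict_le_self).trans hcε
  have hf6 : (∫⁻ x, ‖f x‖ₑ ^ (6 : ℝ) ∂μ) ^ (1 / 6 : ℝ) ≤ CS * (E ^ (1 / 2 : ℝ) + Gg ^ (1 / 2 : ℝ)) := by
    have e : eLpNorm f 6 μ = (∫⁻ x, ‖f x‖ₑ ^ (6 : ℝ) ∂μ) ^ (1 / 6 : ℝ) := by
      rw [eLpNorm_eq_lintegral_rpow_enorm_toReal (by norm_num) ENNReal.ofNat_ne_top, ENNReal.toReal_ofNat]
    rw [← e, ← hE2]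
    exact hSob
  have hf2 : (∫⁻ x, ‖f x‖ₑ ^ (2 : ℝ) ∂μ) ^ (1 / 2 : ℝ) = E ^ (1 / 2 : ℝ) := by
    congr 1
    exact lintegral_congr fun x => by rw [show (2 : ℝ) = ((2 : ℕ) : ℝ) by norm_num, ENNReal.rpow_natCast]
  have hcpart : ∫⁻ x, ‖c x‖ₑ * ‖f x‖ₑ ^ 2 ∂μ ≤
      ENNReal.ofReal ε * (CS * (E ^ (1 / 2 : ℝ) + Gg ^ (1 / 2 : ℝ))) * E ^ (1 / 2 : ℝ) := by
    calc ∫⁻ x, ‖c x‖ₑ * ‖f x‖ₑ ^ 2 ∂μ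
        ≤ (∫⁻ x, ‖c x‖ₑ ^ (3 : ℝ) ∂μ) ^ (1 / 3 : ℝ) * (∫⁻ x, ‖f x‖ₑ ^ (6 : ℝ) ∂μ) ^ (1 / 6 : ℝ) *
            (∫⁻ x, ‖f x‖ₑ ^ (2 : ℝ) ∂μ) ^ (1 / 2 : ℝ) := hH
      _ ≤ ENNReal.ofReal ε * (CS * (E ^ (1 / 2 : ℝ) + Gg ^ (1 / 2 : ℝ))) * E ^ (1 / 2 : ℝ) := by
          rw [hf2]
          exact mul_le_mul' (mul_le_mul' hc3 hf6) le_rfl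
  calc ∫⁻ x, ‖a x‖ₑ * ‖f x‖ₑ ^ 2 ∂μ ≤ ∫⁻ x, (‖b x‖ₑ * ‖f x‖ₑ ^ 2 + ‖c x‖ₑ * ‖f x‖ₑ ^ 2) ∂μ :=
        lintegral_mono_ae hsplit
    _ = ∫⁻ x, ‖b x‖ₑ * ‖f x‖ₑ ^ 2 ∂μ + ∫⁻ x, ‖c x‖ₑ * ‖f x‖ₑ ^ 2 ∂μ :=
        lintegral_add_left' (hbμ.enorm.mul (hf.enorm.pow_const 2)) _
    _ ≤ _ := add_le_add hbpart hcpart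

/-! ## Hölder with three factors; the spatial estimate of the stretching term -/

/-- **`∫ a h k ≤ ‖a‖₃ ‖h‖₆ ‖k‖₂`** for `ℝ≥0∞`-valued a.e.-measurable functions (Hölder with
the exponents `3`, `3/2`, then `4`, `4/3` on `h^{3/2} k^{3/2}`), lower-integral form.
[folklore] -/
private theorem lintegral_mul_mul_le_L3_L6_L2' {X : Type*} [MeasurableSpace X] (μ : Measure X)
    {a h k : X → ℝ≥0∞} (ha : AEMeasurable a μ) (hh : AEMeasurable h μ) (hk : AEMeasurable k μ) :
    ∫⁻ x, a x * (h x * k x) ∂μ ≤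
      (∫⁻ x, a x ^ (3 : ℝ) ∂μ) ^ (1 / 3 : ℝ) * (∫⁻ x, h x ^ (6 : ℝ) ∂μ) ^ (1 / 6 : ℝ) *
        (∫⁻ x, k x ^ (2 : ℝ) ∂μ) ^ (1 / 2 : ℝ) := by
  have hpq : (3 : ℝ).HolderConjugate (3 / 2) := by
    have := Real.holderConjugate_one_div (a := 1 / 3) (b := 2 / 3) (by norm_num) (by norm_num)
      (by norm_num)
    norm_num at this
    exact this
  have h1 := ENNReal.lintegral_mul_le_Lp_mul_Lq μ hpq ha (hh.mul hk)
  have hpq' : (4 : ℝ).HolderConjugate (4 / 3) := by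
    have := Real.holderConjugate_one_div (a := 1 / 4) (b := 3 / 4) (by norm_num) (by norm_num)
      (by norm_num)
    norm_num at this
    exact this
  have h2 := ENNReal.lintegral_mul_le_Lp_mul_Lq μ hpq' (hh.pow_const (3 / 2 : ℝ))
    (hk.pow_const (3 / 2 : ℝ))
  have e6 : ∀ x, (h x ^ (3 / 2 : ℝ)) ^ (4 : ℝ) = h x ^ (6 : ℝ) := fun x => by
    rw [← ENNReal.rpow_mul]; norm_num
  have e2 : ∀ x, (k x ^ (3 / 2 : ℝ)) ^ (4 / 3 : ℝ) = k x ^ (2 : ℝ) := fun x => by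
    rw [← ENNReal.rpow_mul]; norm_num
  simp only [Pi.mul_apply, e6, e2] at h2
  have h3 : (∫⁻ x, (h x * k x) ^ (3 / 2 : ℝ) ∂μ) ^ (1 / (3 / 2 : ℝ)) ≤
      (∫⁻ x, h x ^ (6 : ℝ) ∂μ) ^ (1 / 6 : ℝ) * (∫⁻ x, k x ^ (2 : ℝ) ∂μ) ^ (1 / 2 : ℝ) := by
    have e : ∫⁻ x, (h x * k x) ^ (3 / 2 : ℝ) ∂μ = ∫⁻ x, h x ^ (3 / 2 : ℝ) * k x ^ (3 / 2 : ℝ) ∂μ :=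
      lintegral_congr fun x => ENNReal.mul_rpow_of_nonneg _ _ (by norm_num)
    rw [e, show (1 : ℝ) / (3 / 2) = 2 / 3 by norm_num]
    calc (∫⁻ x, h x ^ (3 / 2 : ℝ) * k x ^ (3 / 2 : ℝ) ∂μ) ^ (2 / 3 : ℝ)
        ≤ ((∫⁻ x, h x ^ (6 : ℝ) ∂μ) ^ (1 / 4 : ℝ) * (∫⁻ x, k x ^ (2 : ℝ) ∂μ) ^ (1 / (4 / 3) : ℝ)) ^
            (2 / 3 : ℝ) := ENNReal.rpow_le_rpow h2 (by norm_num)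
      _ = (∫⁻ x, h x ^ (6 : ℝ) ∂μ) ^ (1 / 6 : ℝ) * (∫⁻ x, k x ^ (2 : ℝ) ∂μ) ^ (1 / 2 : ℝ) := by
          rw [ENNReal.mul_rpow_of_nonneg _ _ (by norm_num), ← ENNReal.rpow_mul, ← ENNReal.rpow_mul]
          norm_num
  calc ∫⁻ x, a x * (h x * k x) ∂μ ≤ (∫⁻ x, a x ^ (3 : ℝ) ∂μ) ^ (1 / 3 : ℝ) *
        (∫⁻ x, (h x * k x) ^ (3 / 2 : ℝ) ∂μ) ^ (1 / (3 / 2 : ℝ)) := by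
        simpa only [Pi.mul_apply] using h1
    _ ≤ (∫⁻ x, a x ^ (3 : ℝ) ∂μ) ^ (1 / 3 : ℝ) *
        ((∫⁻ x, h x ^ (6 : ℝ) ∂μ) ^ (1 / 6 : ℝ) * (∫⁻ x, k x ^ (2 : ℝ) ∂μ) ^ (1 / 2 : ℝ)) :=
        mul_le_mul_right h3 _
    _ = _ := by ring

/-- **`∫_B |a| |g|_F |f| ≤ m ‖g‖_{L²(B)}‖f‖_{L²(B)} + ε C_S (‖f‖_{L²(B)} + ‖g‖_{L²(B)}) ‖g‖_{L²(B)}` on a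
ball `B = B(x₀,R)`** (`|g|_F` the Frobenius norm), for `a = b + c` a.e. with `|b| ≤ m` a.e.,
`‖c‖_{L³} ≤ ε`, and `f` with the Sobolev inequality `‖f‖_{L⁶(B)} ≤ C_S(‖f‖_{L²(B)} + ‖g‖_{L²(B)})`:
the `b`-part by Cauchy–Schwarz, the `c`-part by Hölder with the exponents `3`, `6`, `2`. This is
the spatial half of the printed "`-∫φ u₁·(w·∇w) ≤ Cγ(∫‖u₃‖²_∞α²)^{1/2} + C‖u₄‖γ(γ² + ∫α²)^{1/2}`"
bookkeeping (Lemarié-Rieusset 2016, p. 517), `‖(∇w)w‖ ≤ |∇w|_F|w|`. [folklore] -/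
theorem lintegral_ball_mul_frob_mul_le_of_split {a b c f : (EuclideanSpace ℝ (Fin 3)) → (EuclideanSpace ℝ (Fin 3))}
    {g : (EuclideanSpace ℝ (Fin 3)) → (EuclideanSpace ℝ (Fin 3)) →L[ℝ] (EuclideanSpace ℝ (Fin 3))}
    {x₀ : EuclideanSpace ℝ (Fin 3)} {R mval ε : ℝ} {CS : ℝ≥0}
    (hb : AEStronglyMeasurable b volume) (hc : AEStronglyMeasurable c volume)
    (hf : AEStronglyMeasurable f (volume.restrict (ball x₀ R)))
    (hg : AEStronglyMeasurable g (volume.restrict (ball x₀ R)))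
    (habc : ∀ᵐ x ∂(volume : Measure (EuclideanSpace ℝ (Fin 3))), a x = b x + c x)
    (hbm : ∀ᵐ x ∂(volume : Measure (EuclideanSpace ℝ (Fin 3))), ‖b x‖ₑ ≤ ENNReal.ofReal mval)
    (hcε : eLpNorm c 3 volume ≤ ENNReal.ofReal ε)
    (hSob : eLpNorm f 6 (volume.restrict (ball x₀ R)) ≤
      CS * (eLpNorm f 2 (volume.restrict (ball x₀ R)) +
        (∫⁻ x in ball x₀ R, ENNReal.ofReal (frobeniusNormSq (g x))) ^ (1 / 2 : ℝ))) :
    ∫⁻ x in ball x₀ R, ‖a x‖ₑ * (ENNReal.ofReal (Real.sqrt (frobeniusNormSq (g x))) * ‖f x‖ₑ) ≤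
      ENNReal.ofReal mval * (∫⁻ x in ball x₀ R, ENNReal.ofReal (frobeniusNormSq (g x))) ^ (1 / 2 : ℝ) *
          (∫⁻ x in ball x₀ R, ‖f x‖ₑ ^ 2) ^ (1 / 2 : ℝ) +
        ENNReal.ofReal ε * (CS * ((∫⁻ x in ball x₀ R, ‖f x‖ₑ ^ 2) ^ (1 / 2 : ℝ) +
          (∫⁻ x in ball x₀ R, ENNReal.ofReal (frobeniusNormSq (g x))) ^ (1 / 2 : ℝ))) *
          (∫⁻ x in ball x₀ R, ENNReal.ofReal (frobeniusNormSq (g x))) ^ (1 / 2 : ℝ) := by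
  set μ : Measure (EuclideanSpace ℝ (Fin 3)) := volume.restrict (ball x₀ R) with hμ
  set E : ℝ≥0∞ := ∫⁻ x, ‖f x‖ₑ ^ 2 ∂μ with hE
  set Gg : ℝ≥0∞ := ∫⁻ x, ENNReal.ofReal (frobeniusNormSq (g x)) ∂μ with hGg
  set k : (EuclideanSpace ℝ (Fin 3)) → ℝ≥0∞ := fun x => ENNReal.ofReal (Real.sqrt (frobeniusNormSq (g x))) with hk
  have hbμ : AEStronglyMeasurable b μ := hb.restrict
  have hcμ : AEStronglyMeasurable c μ := hc.restrict
  have hkm : AEMeasurable k μ :=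
    ((ENNReal.continuous_ofReal.comp (Real.continuous_sqrt.comp
      NSWeakStrongUniqueness.continuous_frobeniusNormSq)).comp_aestronglyMeasurable hg).aemeasurable
  have hk2 : ∀ x, k x ^ (2 : ℝ) = ENNReal.ofReal (frobeniusNormSq (g x)) := fun x => by
    simp only [hk]
    rw [show (2 : ℝ) = ((2 : ℕ) : ℝ) by norm_num, ENNReal.rpow_natCast,
      ← ENNReal.ofReal_pow (Real.sqrt_nonneg _), Real.sq_sqrt (frobeniusNormSq_nonneg _)]
  have hk2' : ∀ x, k x ^ 2 = ENNReal.ofReal (frobeniusNormSq (g x)) := fun x => by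
    rw [← hk2 x, show (2 : ℝ) = ((2 : ℕ) : ℝ) by norm_num, ENNReal.rpow_natCast]
  have hGk : ∫⁻ x, k x ^ (2 : ℝ) ∂μ = Gg := lintegral_congr fun x => hk2 x
  -- `E^{1/2} = ‖f‖_{L²(B)}`
  have hE2 : eLpNorm f 2 μ = E ^ (1 / 2 : ℝ) := by
    rw [eLpNorm_eq_lintegral_rpow_enorm_toReal two_ne_zero ENNReal.ofNat_ne_top, ENNReal.toReal_ofNat, hE]
    congr 1
    exact lintegral_congr fun x => by rw [show (2 : ℝ) = ((2 : ℕ) : ℝ) by norm_num, ENNReal.rpow_natCast]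
  have hf2 : (∫⁻ x, ‖f x‖ₑ ^ (2 : ℝ) ∂μ) = E :=
    lintegral_congr fun x => by rw [show (2 : ℝ) = ((2 : ℕ) : ℝ) by norm_num, ENNReal.rpow_natCast]
  -- splitting
  have hsplit : ∀ᵐ x ∂μ, ‖a x‖ₑ * (k x * ‖f x‖ₑ) ≤ ‖b x‖ₑ * (k x * ‖f x‖ₑ) + ‖c x‖ₑ * (k x * ‖f x‖ₑ) := by
    filter_upwards [ae_restrict_of_ae (s := ball x₀ R) habc] with x hx
    rw [hx, ← add_mul]
    exact mul_le_mul_left (enorm_add_le _ _) _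
  -- the `b`-part: Cauchy–Schwarz
  have hpq2 : (2 : ℝ).HolderConjugate 2 := by
    have := Real.holderConjugate_one_div (a := 1 / 2) (b := 1 / 2) (by norm_num) (by norm_num)
      (by norm_num)
    norm_num at this
    exact this
  have hbpart : ∫⁻ x, ‖b x‖ₑ * (k x * ‖f x‖ₑ) ∂μ ≤ ENNReal.ofReal mval * Gg ^ (1 / 2 : ℝ) * E ^ (1 / 2 : ℝ) := by
    have hCS := ENNReal.lintegral_mul_le_Lp_mul_Lq μ hpq2 hkm hf.enorm
    simp only [Pi.mul_apply] at hCS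
    rw [hGk, hf2] at hCS
    calc ∫⁻ x, ‖b x‖ₑ * (k x * ‖f x‖ₑ) ∂μ ≤ ∫⁻ x, ENNReal.ofReal mval * (k x * ‖f x‖ₑ) ∂μ :=
          lintegral_mono_ae ((ae_restrict_of_ae (s := ball x₀ R) hbm).mono fun x hx =>
            mul_le_mul_left hx _)
      _ = ENNReal.ofReal mval * ∫⁻ x, k x * ‖f x‖ₑ ∂μ := lintegral_const_mul' _ _ ENNReal.ofReal_ne_top
      _ ≤ ENNReal.ofReal mval * (Gg ^ (1 / 2 : ℝ) * E ^ (1 / 2 : ℝ)) := mul_le_mul_right hCS _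
      _ = _ := by ring
  -- the `c`-part: Hölder `3, 6, 2`
  have hH := lintegral_mul_mul_le_L3_L6_L2' μ hcμ.enorm hf.enorm hkm
  have hc3 : (∫⁻ x, ‖c x‖ₑ ^ (3 : ℝ) ∂μ) ^ (1 / 3 : ℝ) ≤ ENNReal.ofReal ε := by
    have e : eLpNorm c 3 μ = (∫⁻ x, ‖c x‖ₑ ^ (3 : ℝ) ∂μ) ^ (1 / 3 : ℝ) := by
      rw [eLpNorm_eq_lintegral_rpow_enorm_toReal (by norm_num) ENNReal.ofNat_ne_top, ENNReal.toReal_ofNat]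
    rw [← e]
    exact (eLpNorm_mono_measure c Measure.restrict_le_self).trans hcε
  have hf6 : (∫⁻ x, ‖f x‖ₑ ^ (6 : ℝ) ∂μ) ^ (1 / 6 : ℝ) ≤ CS * (E ^ (1 / 2 : ℝ) + Gg ^ (1 / 2 : ℝ)) := by
    have e : eLpNorm f 6 μ = (∫⁻ x, ‖f x‖ₑ ^ (6 : ℝ) ∂μ) ^ (1 / 6 : ℝ) := by
      rw [eLpNorm_eq_lintegral_rpow_enorm_toReal (by norm_num) ENNReal.ofNat_ne_top, ENNReal.toReal_ofNat]
    rw [← e, ← hE2]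
    exact hSob
  have hcpart : ∫⁻ x, ‖c x‖ₑ * (k x * ‖f x‖ₑ) ∂μ ≤
      ENNReal.ofReal ε * (CS * (E ^ (1 / 2 : ℝ) + Gg ^ (1 / 2 : ℝ))) * Gg ^ (1 / 2 : ℝ) := by
    have e : ∫⁻ x, ‖c x‖ₑ * (k x * ‖f x‖ₑ) ∂μ = ∫⁻ x, ‖c x‖ₑ * (‖f x‖ₑ * k x) ∂μ :=
      lintegral_congr fun x => by rw [mul_comm (k x)]
    rw [e]
    calc ∫⁻ x, ‖c x‖ₑ * (‖f x‖ₑ * k x) ∂μ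
        ≤ (∫⁻ x, ‖c x‖ₑ ^ (3 : ℝ) ∂μ) ^ (1 / 3 : ℝ) * (∫⁻ x, ‖f x‖ₑ ^ (6 : ℝ) ∂μ) ^ (1 / 6 : ℝ) *
            (∫⁻ x, k x ^ (2 : ℝ) ∂μ) ^ (1 / 2 : ℝ) := hH
      _ ≤ ENNReal.ofReal ε * (CS * (E ^ (1 / 2 : ℝ) + Gg ^ (1 / 2 : ℝ))) * Gg ^ (1 / 2 : ℝ) := by
          rw [hGk]
          exact mul_le_mul' (mul_le_mul' hc3 hf6) le_rfl
  calc ∫⁻ x, ‖a x‖ₑ * (k x * ‖f x‖ₑ) ∂μ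
      ≤ ∫⁻ x, (‖b x‖ₑ * (k x * ‖f x‖ₑ) + ‖c x‖ₑ * (k x * ‖f x‖ₑ)) ∂μ := lintegral_mono_ae hsplit
    _ = ∫⁻ x, ‖b x‖ₑ * (k x * ‖f x‖ₑ) ∂μ + ∫⁻ x, ‖c x‖ₑ * (k x * ‖f x‖ₑ) ∂μ :=
        lintegral_add_left' (hbμ.enorm.mul (hkm.mul hf.enorm)) _
    _ ≤ _ := add_le_add hbpart hcpart

/-! ## Time integration: the transport and stretching cylinders -/

namespace LemarieRieusset2016

variable {ν T : ℝ} {u₀ : (EuclideanSpace ℝ (Fin 3)) → (EuclideanSpace ℝ (Fin 3))}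
  {u₁ u₂ : ℝ → (EuclideanSpace ℝ (Fin 3)) → (EuclideanSpace ℝ (Fin 3))}
  {p₁ p₂ : ℝ → (EuclideanSpace ℝ (Fin 3)) → ℝ}
  {u₃ u₄ : ℝ → (EuclideanSpace ℝ (Fin 3)) → (EuclideanSpace ℝ (Fin 3))} {m : ℝ → ℝ} {ε : ℝ}
  {G₁ G₂ : ℝ → (EuclideanSpace ℝ (Fin 3)) → (EuclideanSpace ℝ (Fin 3)) →L[ℝ] (EuclideanSpace ℝ (Fin 3))}

/-- The cylinder `(0,t) × B(x₀,R)` as a product of restricted measures. [folklore] -/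
theorem volume_restrict_cylinder_eq_prod (t : ℝ) (x₀ : EuclideanSpace ℝ (Fin 3)) (R : ℝ) :
    (volume.restrict (Ioo (0 : ℝ) t ×ˢ ball x₀ R) : Measure (ℝ × EuclideanSpace ℝ (Fin 3))) =
      ((volume : Measure ℝ).restrict (Ioo 0 t)).prod
        ((volume : Measure (EuclideanSpace ℝ (Fin 3))).restrict (ball x₀ R)) := by
  rw [Measure.prod_restrict, ← Measure.volume_eq_prod]

/-- **The good slices, quantitatively.** For a.e. `s ∈ (0,T)` and every centre `x₀` and radius
`R`: `∫_{B(x₀,R)} |u₁ s||w s|² ≤ m(s) E + ε C_S (E^{1/2} + G^{1/2}) E^{1/2}` and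
`∫_{B(x₀,R)} |u₁ s| |∇w s|_F |w s| ≤ m(s) G^{1/2}E^{1/2} + ε C_S (E^{1/2} + G^{1/2}) G^{1/2}`, where
`w = u₁ - u₂`, `E = ∫_{B(x₀,R)}|w s|²`, `G = ∫_{B(x₀,R)}|G₁ s - G₂ s|²_F`, `C_S = C_S(R)` the
centre-uniform Sobolev constant, as soon as `E < ∞` (the slice data of `ae_slice`, the
splitting `u₁ s = u₃ s + (u₁ s - u₃ s)` with `u₁ s - u₃ s = u₄ s` a.e., and the two spatial
estimates). [folklore] -/
theorem WeakStrongSetting.ae_slice_ball_estimates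
    (hS : WeakStrongSetting ν T u₀ u₁ u₂ p₁ p₂ u₃ u₄ m ε G₁ G₂) {R : ℝ} {CS : ℝ≥0}
    (hCS : ∀ (y : EuclideanSpace ℝ (Fin 3)) (f : (EuclideanSpace ℝ (Fin 3)) → (EuclideanSpace ℝ (Fin 3)))
      (g : (EuclideanSpace ℝ (Fin 3)) → (EuclideanSpace ℝ (Fin 3)) →L[ℝ] (EuclideanSpace ℝ (Fin 3))),
      FunctionSpaces.HasWeakFDerivOn (⟨ball y R, isOpen_ball⟩ : Opens (EuclideanSpace ℝ (Fin 3))) volume f g →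
      eLpNorm f 2 (volume.restrict (ball y R)) ≠ ∞ →
      eLpNorm f 6 (volume.restrict (ball y R)) ≤
        CS * (eLpNorm f 2 (volume.restrict (ball y R)) +
          (∫⁻ x in ball y R, ENNReal.ofReal (frobeniusNormSq (g x))) ^ (1 / 2 : ℝ))) :
    ∀ᵐ s ∂(volume.restrict (Ioo 0 T)), ∀ x₀ : EuclideanSpace ℝ (Fin 3),
      (∫⁻ x in ball x₀ R, ‖u₁ s x - u₂ s x‖ₑ ^ 2) ≠ ∞ →
      (∫⁻ x in ball x₀ R, ‖u₁ s x‖ₑ * ‖u₁ s x - u₂ s x‖ₑ ^ 2 ≤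
        ENNReal.ofReal (m s) * (∫⁻ x in ball x₀ R, ‖u₁ s x - u₂ s x‖ₑ ^ 2) +
          ENNReal.ofReal ε * (CS * ((∫⁻ x in ball x₀ R, ‖u₁ s x - u₂ s x‖ₑ ^ 2) ^ (1 / 2 : ℝ) +
            (∫⁻ x in ball x₀ R, ENNReal.ofReal (frobeniusNormSq (G₁ s x - G₂ s x))) ^ (1 / 2 : ℝ))) *
            (∫⁻ x in ball x₀ R, ‖u₁ s x - u₂ s x‖ₑ ^ 2) ^ (1 / 2 : ℝ)) ∧
      (∫⁻ x in ball x₀ R, ‖u₁ s x‖ₑ *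
          (ENNReal.ofReal (Real.sqrt (frobeniusNormSq (G₁ s x - G₂ s x))) * ‖u₁ s x - u₂ s x‖ₑ) ≤
        ENNReal.ofReal (m s) *
            (∫⁻ x in ball x₀ R, ENNReal.ofReal (frobeniusNormSq (G₁ s x - G₂ s x))) ^ (1 / 2 : ℝ) *
            (∫⁻ x in ball x₀ R, ‖u₁ s x - u₂ s x‖ₑ ^ 2) ^ (1 / 2 : ℝ) +
          ENNReal.ofReal ε * (CS * ((∫⁻ x in ball x₀ R, ‖u₁ s x - u₂ s x‖ₑ ^ 2) ^ (1 / 2 : ℝ) +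
            (∫⁻ x in ball x₀ R, ENNReal.ofReal (frobeniusNormSq (G₁ s x - G₂ s x))) ^ (1 / 2 : ℝ))) *
            (∫⁻ x in ball x₀ R, ENNReal.ofReal (frobeniusNormSq (G₁ s x - G₂ s x))) ^ (1 / 2 : ℝ)) := by
  -- measurability of the gradient slices
  have hGm : ∀ᵐ s ∂(volume.restrict (Ioo 0 T)), AEStronglyMeasurable (fun x => G₁ s x - G₂ s x) volume := by
    have h : AEStronglyMeasurable (uncurry fun s x => G₁ s x - G₂ s x)
        (volume.restrict (Ioo 0 T ×ˢ (univ : Set (EuclideanSpace ℝ (Fin 3))))) :=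
      hS.grad₁.locallyIntegrableOn_grad.aestronglyMeasurable.sub
        hS.grad₂.locallyIntegrableOn_grad.aestronglyMeasurable
    rw [volume_restrict_strip_eq_prod] at h
    exact h.prodMk_left
  filter_upwards [hS.ae_slice, hGm] with s hs hg x₀ hE
  obtain ⟨hm₁, hm₂, hm₃, hsplit, hbd, hε₄, hderiv⟩ := hs
  -- the splitting `u₁ s = u₃ s + (u₁ s - u₃ s)`, with `u₁ s - u₃ s = u₄ s` a.e.
  have habc : ∀ᵐ x ∂(volume : Measure (EuclideanSpace ℝ (Fin 3))),
      u₁ s x = u₃ s x + (u₁ s x - u₃ s x) := Eventually.of_forall fun x => by abel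
  have hc : AEStronglyMeasurable (fun x => u₁ s x - u₃ s x) volume := hm₁.sub hm₃
  have hcε : eLpNorm (fun x => u₁ s x - u₃ s x) 3 volume ≤ ENNReal.ofReal ε := by
    have e : (fun x => u₁ s x - u₃ s x) =ᵐ[volume] u₄ s := by
      filter_upwards [hsplit] with x hx
      rw [hx]
      abel
    rw [eLpNorm_congr_ae e]
    exact hε₄
  have hf : AEStronglyMeasurable (fun x => u₁ s x - u₂ s x) (volume.restrict (ball x₀ R)) :=
    (hm₁.sub hm₂).restrict
  have hgR : AEStronglyMeasurable (fun x => G₁ s x - G₂ s x) (volume.restrict (ball x₀ R)) := hg.restrict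
  have hderivB : FunctionSpaces.HasWeakFDerivOn (⟨ball x₀ R, isOpen_ball⟩ : Opens (EuclideanSpace ℝ (Fin 3)))
      volume (fun x => u₁ s x - u₂ s x) (fun x => G₁ s x - G₂ s x) :=
    FunctionSpaces.HasWeakFDerivOn.mono_set_holds hderiv le_top
  have hE2 : eLpNorm (fun x => u₁ s x - u₂ s x) 2 (volume.restrict (ball x₀ R)) ≠ ∞ := by
    rw [eLpNorm_eq_lintegral_rpow_enorm_toReal two_ne_zero ENNReal.ofNat_ne_top, ENNReal.toReal_ofNat]
    refine ENNReal.rpow_ne_top_of_nonneg (by norm_num) ?_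
    have e : ∫⁻ x in ball x₀ R, ‖u₁ s x - u₂ s x‖ₑ ^ (2 : ℝ) = ∫⁻ x in ball x₀ R, ‖u₁ s x - u₂ s x‖ₑ ^ 2 :=
      lintegral_congr fun x => by rw [show (2 : ℝ) = ((2 : ℕ) : ℝ) by norm_num, ENNReal.rpow_natCast]
    rw [e]
    exact hE
  have hSob := hCS x₀ _ _ hderivB hE2
  exact ⟨lintegral_ball_mul_sq_le_of_split hm₃ hc hf habc hbd hcε hSob,
    lintegral_ball_mul_frob_mul_le_of_split hm₃ hc hf hgR habc hbd hcε hSob⟩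

end LemarieRieusset2016

namespace LemarieRieusset2016

variable {ν T : ℝ} {u₀ : (EuclideanSpace ℝ (Fin 3)) → (EuclideanSpace ℝ (Fin 3))}
  {u₁ u₂ : ℝ → (EuclideanSpace ℝ (Fin 3)) → (EuclideanSpace ℝ (Fin 3))}
  {p₁ p₂ : ℝ → (EuclideanSpace ℝ (Fin 3)) → ℝ}
  {u₃ u₄ : ℝ → (EuclideanSpace ℝ (Fin 3)) → (EuclideanSpace ℝ (Fin 3))} {m : ℝ → ℝ} {ε : ℝ}
  {G₁ G₂ : ℝ → (EuclideanSpace ℝ (Fin 3)) → (EuclideanSpace ℝ (Fin 3)) →L[ℝ] (EuclideanSpace ℝ (Fin 3))}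

/-- Measurability in time of the ball energies `s ↦ ∫_{B(x₀,R)} |u₁ s - u₂ s|²` and of the
ball gradient energies `s ↦ ∫_{B(x₀,R)} |G₁ s - G₂ s|²_F` in the setting (Tonelli), and the
Tonelli identities for the transport and stretching cylinders. [folklore] -/
theorem WeakStrongSetting.tonelli_data (hS : WeakStrongSetting ν T u₀ u₁ u₂ p₁ p₂ u₃ u₄ m ε G₁ G₂)
    {t : ℝ} (ht : t ≤ T) (x₀ : EuclideanSpace ℝ (Fin 3)) (R : ℝ) :
    AEMeasurable (fun s => ∫⁻ x in ball x₀ R, ‖u₁ s x - u₂ s x‖ₑ ^ 2) (volume.restrict (Ioo 0 t)) ∧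
    AEMeasurable (fun s => ∫⁻ x in ball x₀ R, ENNReal.ofReal (frobeniusNormSq (G₁ s x - G₂ s x)))
      (volume.restrict (Ioo 0 t)) ∧
    (∫⁻ z in Ioo 0 t ×ˢ ball x₀ R, ‖u₁ z.1 z.2‖ₑ * ‖u₁ z.1 z.2 - u₂ z.1 z.2‖ₑ ^ 2 =
      ∫⁻ s in Ioo 0 t, ∫⁻ x in ball x₀ R, ‖u₁ s x‖ₑ * ‖u₁ s x - u₂ s x‖ₑ ^ 2) ∧
    (∫⁻ z in Ioo 0 t ×ˢ ball x₀ R, ‖u₁ z.1 z.2‖ₑ *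
        (ENNReal.ofReal (Real.sqrt (frobeniusNormSq (G₁ z.1 z.2 - G₂ z.1 z.2))) * ‖u₁ z.1 z.2 - u₂ z.1 z.2‖ₑ) =
      ∫⁻ s in Ioo 0 t, ∫⁻ x in ball x₀ R, ‖u₁ s x‖ₑ *
        (ENNReal.ofReal (Real.sqrt (frobeniusNormSq (G₁ s x - G₂ s x))) * ‖u₁ s x - u₂ s x‖ₑ)) ∧
    (∫⁻ z in Ioo 0 t ×ˢ ball x₀ R, ENNReal.ofReal (frobeniusNormSq (G₁ z.1 z.2 - G₂ z.1 z.2)) =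
      ∫⁻ s in Ioo 0 t, ∫⁻ x in ball x₀ R, ENNReal.ofReal (frobeniusNormSq (G₁ s x - G₂ s x))) ∧
    (∫⁻ z in Ioo 0 t ×ˢ ball x₀ R, ‖u₁ z.1 z.2 - u₂ z.1 z.2‖ₑ ^ 2 =
      ∫⁻ s in Ioo 0 t, ∫⁻ x in ball x₀ R, ‖u₁ s x - u₂ s x‖ₑ ^ 2) := by
  have hsub : Ioo (0 : ℝ) t ×ˢ ball x₀ R ⊆ Ioo 0 T ×ˢ (univ : Set (EuclideanSpace ℝ (Fin 3))) :=
    prod_mono (Ioo_subset_Ioo_right ht) (subset_univ _)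
  set μ : Measure (ℝ × EuclideanSpace ℝ (Fin 3)) :=
    ((volume : Measure ℝ).restrict (Ioo 0 t)).prod ((volume : Measure (EuclideanSpace ℝ (Fin 3))).restrict (ball x₀ R)) with hμ
  have hprod := volume_restrict_cylinder_eq_prod t x₀ R
  have hu₁ : AEStronglyMeasurable (uncurry u₁) μ := by
    rw [hμ, ← hprod]; exact hS.sol₁.aestronglyMeasurable.mono_measure (Measure.restrict_mono hsub le_rfl)
  have hu₂ : AEStronglyMeasurable (uncurry u₂) μ := by
    rw [hμ, ← hprod]; exact hS.sol₂.aestronglyMeasurable.mono_measure (Measure.restrict_mono hsub le_rfl)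
  have hG : AEStronglyMeasurable (uncurry fun s x => G₁ s x - G₂ s x) μ := by
    have h : AEStronglyMeasurable (uncurry fun s x => G₁ s x - G₂ s x)
        (volume.restrict (Ioo 0 T ×ˢ (univ : Set (EuclideanSpace ℝ (Fin 3))))) :=
      hS.grad₁.locallyIntegrableOn_grad.aestronglyMeasurable.sub
        hS.grad₂.locallyIntegrableOn_grad.aestronglyMeasurable
    rw [hμ, ← hprod]; exact h.mono_measure (Measure.restrict_mono hsub le_rfl)
  have hw : AEMeasurable (fun z : ℝ × EuclideanSpace ℝ (Fin 3) => ‖uncurry u₁ z - uncurry u₂ z‖ₑ ^ 2) μ :=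
    (hu₁.sub hu₂).enorm.pow_const 2
  have hF : AEMeasurable (fun z : ℝ × EuclideanSpace ℝ (Fin 3) =>
      ENNReal.ofReal (frobeniusNormSq (uncurry (fun s x => G₁ s x - G₂ s x) z))) μ :=
    ((ENNReal.continuous_ofReal.comp
      NSWeakStrongUniqueness.continuous_frobeniusNormSq).comp_aestronglyMeasurable hG).aemeasurable
  have hk : AEMeasurable (fun z : ℝ × EuclideanSpace ℝ (Fin 3) =>
      ENNReal.ofReal (Real.sqrt (frobeniusNormSq (uncurry (fun s x => G₁ s x - G₂ s x) z)))) μ :=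
    ((ENNReal.continuous_ofReal.comp (Real.continuous_sqrt.comp
      NSWeakStrongUniqueness.continuous_frobeniusNormSq)).comp_aestronglyMeasurable hG).aemeasurable
  refine ⟨hw.lintegral_prod_right', hF.lintegral_prod_right', ?_, ?_, ?_, ?_⟩
  · rw [hprod]; exact lintegral_prod _ (hu₁.enorm.mul hw)
  · rw [hprod]; exact lintegral_prod _ (hu₁.enorm.mul (hk.mul (hu₁.sub hu₂).enorm))
  · rw [hprod]; exact lintegral_prod _ hF
  · rw [hprod]; exact lintegral_prod _ hw

/-- **The transport cylinder** (Lemarié-Rieusset 2016, p. 517: the bounds of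
`∫₀ᵗ∫(w·∇φ)(u₁·w)` and `∫₀ᵗ∫(u₁·∇φ)|w|²/2` by `C∫₀ᵗ‖u₃‖_∞α² + C‖u₄‖(γ² + ∫₀ᵗα²)`): for every
radius `R` there is `C = C(R)` with
`∫₀ᵗ∫_{B(x₀,R)} |u₁||u₁ - u₂|² ≤ C(∫₀ᵗ m α² + ε(γ(t)² + ∫₀ᵗα²))` in every setting, for every
centre `x₀` and `t ∈ (0,T]` (Tonelli, the good-slice estimate `ae_slice_ball_estimates`,
`√(GE) ≤ G + E`, the coverings of `B(x₀,R)` and of the cylinder by unit balls / cylinders).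
[folklore] -/
theorem exists_cylinder_transport_bound (R : ℝ) :
    ∃ C : ℝ≥0, ∀ {ν T : ℝ} {u₀ : (EuclideanSpace ℝ (Fin 3)) → (EuclideanSpace ℝ (Fin 3))}
      {u₁ u₂ : ℝ → (EuclideanSpace ℝ (Fin 3)) → (EuclideanSpace ℝ (Fin 3))}
      {p₁ p₂ : ℝ → (EuclideanSpace ℝ (Fin 3)) → ℝ}
      {u₃ u₄ : ℝ → (EuclideanSpace ℝ (Fin 3)) → (EuclideanSpace ℝ (Fin 3))} {m : ℝ → ℝ} {ε : ℝ}
      {G₁ G₂ : ℝ → (EuclideanSpace ℝ (Fin 3)) → (EuclideanSpace ℝ (Fin 3)) →L[ℝ] (EuclideanSpace ℝ (Fin 3))},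
      WeakStrongSetting ν T u₀ u₁ u₂ p₁ p₂ u₃ u₄ m ε G₁ G₂ →
      ∀ (x₀ : EuclideanSpace ℝ (Fin 3)) (t : ℝ), t ∈ Ioc 0 T →
        ∫⁻ z in Ioo 0 t ×ˢ ball x₀ R, ‖u₁ z.1 z.2‖ₑ * ‖u₁ z.1 z.2 - u₂ z.1 z.2‖ₑ ^ 2 ≤
          C * ((∫⁻ s in Ioo 0 t, ENNReal.ofReal (m s) * ulocEnergy (u₁ s - u₂ s)) +
            ENNReal.ofReal ε *
              (ulocGradEnergyOn t (G₁ - G₂) + ∫⁻ s in Ioo 0 t, ulocEnergy (u₁ s - u₂ s))) := by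
  obtain ⟨N, hN⟩ := exists_lintegral_ball_le_mul_iSup (E := EuclideanSpace ℝ (Fin 3)) R
  obtain ⟨N', hN'⟩ := exists_lintegral_cylinder_le_mul_iSup (T := ℝ) (E := EuclideanSpace ℝ (Fin 3)) R
  obtain ⟨CS, hCS⟩ := exists_eLpNorm_six_le_ball_uniform (E := EuclideanSpace ℝ (Fin 3))
    finrank_euclideanSpace_fin R
  refine ⟨N + CS * (2 * N + N'), ?_⟩
  intro ν T u₀ u₁ u₂ p₁ p₂ u₃ u₄ m ε G₁ G₂ hS x₀ t ht
  obtain ⟨M, hMtop, hM⟩ := exists_ae_ulocEnergy_sub_le hS.sol₁ hS.sol₂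
  obtain ⟨hEm, hGm, hT₁, -, hTG, hTE⟩ := hS.tonelli_data ht.2 x₀ R
  -- abbreviations
  set A : ℝ → ℝ≥0∞ := fun s => ulocEnergy (u₁ s - u₂ s) with hA
  set E : ℝ → ℝ≥0∞ := fun s => ∫⁻ x in ball x₀ R, ‖u₁ s x - u₂ s x‖ₑ ^ 2 with hE
  set G : ℝ → ℝ≥0∞ := fun s => ∫⁻ x in ball x₀ R, ENNReal.ofReal (frobeniusNormSq (G₁ s x - G₂ s x)) with hG
  set I : ℝ≥0∞ := ∫⁻ s in Ioo 0 t, A s with hI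
  set J₁ : ℝ≥0∞ := ∫⁻ s in Ioo 0 t, ENNReal.ofReal (m s) * A s with hJ₁
  set Γ : ℝ≥0∞ := ulocGradEnergyOn t (G₁ - G₂) with hΓ
  -- `E ≤ N A` pointwise; `∫ E ≤ N I`; `∫ G ≤ N' Γ`
  have hEA : ∀ s, E s ≤ N * A s := fun s => by
    have h := hN volume (fun x => ‖u₁ s x - u₂ s x‖ₑ ^ 2) x₀
    simpa only [hA, ulocEnergy, Pi.sub_apply] using h
  have hIE : ∫⁻ s in Ioo 0 t, E s ≤ N * I :=
    calc ∫⁻ s in Ioo 0 t, E s ≤ ∫⁻ s in Ioo 0 t, N * A s := lintegral_mono fun s => hEA s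
      _ = N * I := lintegral_const_mul' _ _ ENNReal.coe_ne_top
  have hIG : ∫⁻ s in Ioo 0 t, G s ≤ N' * Γ := by
    rw [← hTG]
    have h := hN' volume (Ioo 0 t) (fun z => ENNReal.ofReal (frobeniusNormSq (G₁ z.1 z.2 - G₂ z.1 z.2))) x₀
    simpa only [hΓ, ulocGradEnergyOn, Pi.sub_apply] using h
  -- the good slices on `(0,t)`
  have hgood : ∀ᵐ s ∂(volume.restrict (Ioo 0 t)),
      ∫⁻ x in ball x₀ R, ‖u₁ s x‖ₑ * ‖u₁ s x - u₂ s x‖ₑ ^ 2 ≤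
        ENNReal.ofReal (m s) * E s + ENNReal.ofReal ε * (CS * (E s ^ (1 / 2 : ℝ) + G s ^ (1 / 2 : ℝ))) *
          E s ^ (1 / 2 : ℝ) := by
    have h1 := ae_restrict_of_ae_restrict_of_subset (Ioo_subset_Ioo_right ht.2)
      (hS.ae_slice_ball_estimates hCS)
    have h2 := ae_restrict_of_ae_restrict_of_subset (Ioo_subset_Ioo_right ht.2) hM
    filter_upwards [h1, h2] with s hs hsM
    have hEfin : E s ≠ ∞ :=
      ne_top_of_le_ne_top (ENNReal.mul_ne_top ENNReal.coe_ne_top (ne_top_of_le_ne_top hMtop hsM)) (hEA s)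
    exact (hs x₀ hEfin).1
  -- integrate in time
  have hsplit : ∀ s, ENNReal.ofReal (m s) * E s + ENNReal.ofReal ε * (CS * (E s ^ (1 / 2 : ℝ) + G s ^ (1 / 2 : ℝ))) *
        E s ^ (1 / 2 : ℝ) ≤
      ENNReal.ofReal (m s) * (N * A s) + ENNReal.ofReal ε * CS * (E s + (G s + E s)) := fun s => by
    have hEE : E s ^ (1 / 2 : ℝ) * E s ^ (1 / 2 : ℝ) = E s := by
      rw [← ENNReal.rpow_add_of_nonneg _ _ (by norm_num) (by norm_num)]; norm_num
    have hGE : G s ^ (1 / 2 : ℝ) * E s ^ (1 / 2 : ℝ) ≤ G s + E s := by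
      have h := rpow_mul_rpow_le_add (x := G s) (y := E s) (θ := 1 / 2) (by norm_num) (by norm_num)
      rwa [show (1 : ℝ) - 1 / 2 = 1 / 2 by norm_num] at h
    calc ENNReal.ofReal (m s) * E s + ENNReal.ofReal ε * (CS * (E s ^ (1 / 2 : ℝ) + G s ^ (1 / 2 : ℝ))) *
          E s ^ (1 / 2 : ℝ)
        = ENNReal.ofReal (m s) * E s + ENNReal.ofReal ε * CS *
            (E s ^ (1 / 2 : ℝ) * E s ^ (1 / 2 : ℝ) + G s ^ (1 / 2 : ℝ) * E s ^ (1 / 2 : ℝ)) := by ring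
      _ ≤ ENNReal.ofReal (m s) * (N * A s) + ENNReal.ofReal ε * CS * (E s + (G s + E s)) := by
          rw [hEE]
          gcongr
          exact hEA s
  have hmeas2 : AEMeasurable (fun s => ENNReal.ofReal ε * CS * (E s + (G s + E s))) (volume.restrict (Ioo 0 t)) :=
    (hEm.add (hGm.add hEm)).const_mul _
  calc ∫⁻ z in Ioo 0 t ×ˢ ball x₀ R, ‖u₁ z.1 z.2‖ₑ * ‖u₁ z.1 z.2 - u₂ z.1 z.2‖ₑ ^ 2
      = ∫⁻ s in Ioo 0 t, ∫⁻ x in ball x₀ R, ‖u₁ s x‖ₑ * ‖u₁ s x - u₂ s x‖ₑ ^ 2 := hT₁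
    _ ≤ ∫⁻ s in Ioo 0 t, (ENNReal.ofReal (m s) * (N * A s) + ENNReal.ofReal ε * CS * (E s + (G s + E s))) :=
        lintegral_mono_ae (hgood.mono fun s hs => hs.trans (hsplit s))
    _ = (∫⁻ s in Ioo 0 t, ENNReal.ofReal (m s) * (N * A s)) +
          ∫⁻ s in Ioo 0 t, ENNReal.ofReal ε * CS * (E s + (G s + E s)) := lintegral_add_right' _ hmeas2
    _ = N * J₁ + ENNReal.ofReal ε * CS * ((∫⁻ s in Ioo 0 t, E s) + ((∫⁻ s in Ioo 0 t, G s) + ∫⁻ s in Ioo 0 t, E s)) := by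
        congr 1
        · rw [hJ₁, ← lintegral_const_mul' _ _ ENNReal.coe_ne_top]
          exact lintegral_congr fun s => by ring
        · have hm3 : AEMeasurable (fun s => E s + (G s + E s)) (volume.restrict (Ioo 0 t)) :=
            hEm.add (hGm.add hEm)
          rw [lintegral_const_mul'' _ hm3, lintegral_add_left' hEm, lintegral_add_left' hGm]
    _ ≤ N * J₁ + ENNReal.ofReal ε * CS * (N * I + (N' * Γ + N * I)) := by gcongr
    _ ≤ (N + CS * (2 * N + N') : ℝ≥0) * (J₁ + ENNReal.ofReal ε * (Γ + I)) := by
        push_cast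
        have h1 : (N : ℝ≥0∞) * J₁ ≤ (N + CS * (2 * N + N')) * J₁ := mul_le_mul_left le_self_add _
        have h2 : ENNReal.ofReal ε * CS * (N * I + (N' * Γ + N * I)) ≤
            (N + CS * (2 * N + N')) * (ENNReal.ofReal ε * (Γ + I)) := by
          calc ENNReal.ofReal ε * CS * (N * I + (N' * Γ + N * I))
              = ENNReal.ofReal ε * (CS * (2 * N) * I + CS * N' * Γ) := by ring
            _ ≤ ENNReal.ofReal ε * (CS * (2 * N + N') * I + CS * (2 * N + N') * Γ) := by
                gcongr
                · exact le_self_add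
                · exact le_add_self
            _ = CS * (2 * N + N') * (ENNReal.ofReal ε * (Γ + I)) := by ring
            _ ≤ (N + CS * (2 * N + N')) * (ENNReal.ofReal ε * (Γ + I)) := mul_le_mul_left le_add_self _
        calc (N : ℝ≥0∞) * J₁ + ENNReal.ofReal ε * CS * (N * I + (N' * Γ + N * I))
            ≤ (N + CS * (2 * N + N')) * J₁ + (N + CS * (2 * N + N')) * (ENNReal.ofReal ε * (Γ + I)) :=
              add_le_add h1 h2
          _ = _ := by ring

end LemarieRieusset2016

namespace LemarieRieusset2016

/-- `x^{1/2} ≤ x + 1` in `ℝ≥0∞`. [folklore] -/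
theorem rpow_half_le_add_one (x : ℝ≥0∞) : x ^ (1 / 2 : ℝ) ≤ x + 1 := by
  have h := rpow_mul_rpow_le_add (x := x) (y := 1) (θ := 1 / 2) (by norm_num) (by norm_num)
  rwa [ENNReal.one_rpow, mul_one] at h

/-- **The stretching cylinder** (Lemarié-Rieusset 2016, p. 517: the bound of
`-∫₀ᵗ∫φ u₁·(w·∇w)` by `Cγ(∫₀ᵗ‖u₃‖²_∞α²)^{1/2} + C‖u₄‖γ(γ² + ∫₀ᵗα²)^{1/2}`): for every radius
`R` there is `C = C(R)` with
`∫₀ᵗ∫_{B(x₀,R)} |u₁| |∇w|_F |w| ≤ C(γ(t)(∫₀ᵗ m²α²)^{1/2} + ε(γ(t)² + ∫₀ᵗα²))` in every setting,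
for every centre `x₀` and `t ∈ (0,T]` (Tonelli, the good-slice estimate, `|m| = √(m²)` for the
measurability of the majorant, Cauchy–Schwarz in time, the coverings). [folklore] -/
theorem exists_cylinder_stretching_bound (R : ℝ) :
    ∃ C : ℝ≥0, ∀ {ν T : ℝ} {u₀ : (EuclideanSpace ℝ (Fin 3)) → (EuclideanSpace ℝ (Fin 3))}
      {u₁ u₂ : ℝ → (EuclideanSpace ℝ (Fin 3)) → (EuclideanSpace ℝ (Fin 3))}
      {p₁ p₂ : ℝ → (EuclideanSpace ℝ (Fin 3)) → ℝ}
      {u₃ u₄ : ℝ → (EuclideanSpace ℝ (Fin 3)) → (EuclideanSpace ℝ (Fin 3))} {m : ℝ → ℝ} {ε : ℝ}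
      {G₁ G₂ : ℝ → (EuclideanSpace ℝ (Fin 3)) → (EuclideanSpace ℝ (Fin 3)) →L[ℝ] (EuclideanSpace ℝ (Fin 3))},
      WeakStrongSetting ν T u₀ u₁ u₂ p₁ p₂ u₃ u₄ m ε G₁ G₂ →
      ∀ (x₀ : EuclideanSpace ℝ (Fin 3)) (t : ℝ), t ∈ Ioc 0 T →
        ∫⁻ z in Ioo 0 t ×ˢ ball x₀ R, ‖u₁ z.1 z.2‖ₑ *
            (ENNReal.ofReal (Real.sqrt (frobeniusNormSq (G₁ z.1 z.2 - G₂ z.1 z.2))) *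
              ‖u₁ z.1 z.2 - u₂ z.1 z.2‖ₑ) ≤
          C * (ulocGradEnergyOn t (G₁ - G₂) ^ (1 / 2 : ℝ) *
              (∫⁻ s in Ioo 0 t, ENNReal.ofReal (m s ^ 2) * ulocEnergy (u₁ s - u₂ s)) ^ (1 / 2 : ℝ) +
            ENNReal.ofReal ε *
              (ulocGradEnergyOn t (G₁ - G₂) + ∫⁻ s in Ioo 0 t, ulocEnergy (u₁ s - u₂ s))) := by
  obtain ⟨N, hN⟩ := exists_lintegral_ball_le_mul_iSup (E := EuclideanSpace ℝ (Fin 3)) R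
  obtain ⟨N', hN'⟩ := exists_lintegral_cylinder_le_mul_iSup (T := ℝ) (E := EuclideanSpace ℝ (Fin 3)) R
  obtain ⟨CS, hCS⟩ := exists_eLpNorm_six_le_ball_uniform (E := EuclideanSpace ℝ (Fin 3))
    finrank_euclideanSpace_fin R
  refine ⟨(N + 1) * (N' + 1) + CS * (N + 2 * N'), ?_⟩
  intro ν T u₀ u₁ u₂ p₁ p₂ u₃ u₄ m ε G₁ G₂ hS x₀ t ht
  obtain ⟨M, hMtop, hM⟩ := exists_ae_ulocEnergy_sub_le hS.sol₁ hS.sol₂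
  obtain ⟨hEm, hGm, -, hT₂, hTG, hTE⟩ := hS.tonelli_data ht.2 x₀ R
  -- abbreviations
  set A : ℝ → ℝ≥0∞ := fun s => ulocEnergy (u₁ s - u₂ s) with hA
  set E : ℝ → ℝ≥0∞ := fun s => ∫⁻ x in ball x₀ R, ‖u₁ s x - u₂ s x‖ₑ ^ 2 with hE
  set G : ℝ → ℝ≥0∞ := fun s => ∫⁻ x in ball x₀ R, ENNReal.ofReal (frobeniusNormSq (G₁ s x - G₂ s x)) with hG
  set I : ℝ≥0∞ := ∫⁻ s in Ioo 0 t, A s with hI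
  set J₂ : ℝ≥0∞ := ∫⁻ s in Ioo 0 t, ENNReal.ofReal (m s ^ 2) * A s with hJ₂
  set Γ : ℝ≥0∞ := ulocGradEnergyOn t (G₁ - G₂) with hΓ
  set mt : ℝ → ℝ≥0∞ := fun s => ENNReal.ofReal (Real.sqrt (m s ^ 2)) with hmt
  -- measurability of the majorant surrogate
  have hmtm : AEMeasurable mt (volume.restrict (Ioo 0 t)) := by
    have h : AEMeasurable (fun s => m s ^ 2) (volume.restrict (Ioo 0 t)) :=
      (hS.sqIntegrable_majorant.mono_set (Ioo_subset_Ioo_right ht.2)).aestronglyMeasurable.aemeasurable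
    exact h.sqrt.ennreal_ofReal
  have hm_le : ∀ s, ENNReal.ofReal (m s) ≤ mt s := fun s =>
    ENNReal.ofReal_le_ofReal ((le_abs_self _).trans_eq (Real.sqrt_sq_eq_abs _).symm)
  have hmt2 : ∀ s, mt s ^ (2 : ℝ) = ENNReal.ofReal (m s ^ 2) := fun s => by
    simp only [hmt]
    rw [show (2 : ℝ) = ((2 : ℕ) : ℝ) by norm_num, ENNReal.rpow_natCast,
      ← ENNReal.ofReal_pow (Real.sqrt_nonneg _), Real.sq_sqrt (sq_nonneg _)]
  -- `E ≤ N A`; `∫ E ≤ N I`; `∫ G ≤ N' Γ`; `∫ m² E ≤ N J₂`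
  have hEA : ∀ s, E s ≤ N * A s := fun s => by
    have h := hN volume (fun x => ‖u₁ s x - u₂ s x‖ₑ ^ 2) x₀
    simpa only [hA, ulocEnergy, Pi.sub_apply] using h
  have hIE : ∫⁻ s in Ioo 0 t, E s ≤ N * I :=
    calc ∫⁻ s in Ioo 0 t, E s ≤ ∫⁻ s in Ioo 0 t, N * A s := lintegral_mono fun s => hEA s
      _ = N * I := lintegral_const_mul' _ _ ENNReal.coe_ne_top
  have hIG : ∫⁻ s in Ioo 0 t, G s ≤ N' * Γ := by
    rw [← hTG]
    have h := hN' volume (Ioo 0 t) (fun z => ENNReal.ofReal (frobeniusNormSq (G₁ z.1 z.2 - G₂ z.1 z.2))) x₀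
    simpa only [hΓ, ulocGradEnergyOn, Pi.sub_apply] using h
  have hJE : ∫⁻ s in Ioo 0 t, mt s ^ (2 : ℝ) * E s ≤ N * J₂ :=
    calc ∫⁻ s in Ioo 0 t, mt s ^ (2 : ℝ) * E s ≤ ∫⁻ s in Ioo 0 t, N * (ENNReal.ofReal (m s ^ 2) * A s) :=
          lintegral_mono fun s => by
            rw [hmt2, mul_left_comm]
            exact mul_le_mul_right (hEA s) _
      _ = N * J₂ := lintegral_const_mul' _ _ ENNReal.coe_ne_top
  -- the good slices on `(0,t)`
  have hgood : ∀ᵐ s ∂(volume.restrict (Ioo 0 t)),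
      ∫⁻ x in ball x₀ R, ‖u₁ s x‖ₑ *
          (ENNReal.ofReal (Real.sqrt (frobeniusNormSq (G₁ s x - G₂ s x))) * ‖u₁ s x - u₂ s x‖ₑ) ≤
        ENNReal.ofReal (m s) * G s ^ (1 / 2 : ℝ) * E s ^ (1 / 2 : ℝ) +
          ENNReal.ofReal ε * (CS * (E s ^ (1 / 2 : ℝ) + G s ^ (1 / 2 : ℝ))) * G s ^ (1 / 2 : ℝ) := by
    have h1 := ae_restrict_of_ae_restrict_of_subset (Ioo_subset_Ioo_right ht.2)
      (hS.ae_slice_ball_estimates hCS)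
    have h2 := ae_restrict_of_ae_restrict_of_subset (Ioo_subset_Ioo_right ht.2) hM
    filter_upwards [h1, h2] with s hs hsM
    have hEfin : E s ≠ ∞ :=
      ne_top_of_le_ne_top (ENNReal.mul_ne_top ENNReal.coe_ne_top (ne_top_of_le_ne_top hMtop hsM)) (hEA s)
    exact (hs x₀ hEfin).2
  have hsplit : ∀ s, ENNReal.ofReal (m s) * G s ^ (1 / 2 : ℝ) * E s ^ (1 / 2 : ℝ) +
        ENNReal.ofReal ε * (CS * (E s ^ (1 / 2 : ℝ) + G s ^ (1 / 2 : ℝ))) * G s ^ (1 / 2 : ℝ) ≤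
      mt s * E s ^ (1 / 2 : ℝ) * G s ^ (1 / 2 : ℝ) + ENNReal.ofReal ε * CS * ((E s + G s) + G s) := fun s => by
    have hGG : G s ^ (1 / 2 : ℝ) * G s ^ (1 / 2 : ℝ) = G s := by
      rw [← ENNReal.rpow_add_of_nonneg _ _ (by norm_num) (by norm_num)]; norm_num
    have hEG : E s ^ (1 / 2 : ℝ) * G s ^ (1 / 2 : ℝ) ≤ E s + G s := by
      have h := rpow_mul_rpow_le_add (x := E s) (y := G s) (θ := 1 / 2) (by norm_num) (by norm_num)
      rwa [show (1 : ℝ) - 1 / 2 = 1 / 2 by norm_num] at h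
    calc ENNReal.ofReal (m s) * G s ^ (1 / 2 : ℝ) * E s ^ (1 / 2 : ℝ) +
          ENNReal.ofReal ε * (CS * (E s ^ (1 / 2 : ℝ) + G s ^ (1 / 2 : ℝ))) * G s ^ (1 / 2 : ℝ)
        = ENNReal.ofReal (m s) * E s ^ (1 / 2 : ℝ) * G s ^ (1 / 2 : ℝ) + ENNReal.ofReal ε * CS *
            (E s ^ (1 / 2 : ℝ) * G s ^ (1 / 2 : ℝ) + G s ^ (1 / 2 : ℝ) * G s ^ (1 / 2 : ℝ)) := by ring
      _ ≤ mt s * E s ^ (1 / 2 : ℝ) * G s ^ (1 / 2 : ℝ) + ENNReal.ofReal ε * CS * ((E s + G s) + G s) := by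
          rw [hGG]
          gcongr
          exact hm_le s
  -- Cauchy–Schwarz in time for the majorant term
  have hpq2 : (2 : ℝ).HolderConjugate 2 := by
    have := Real.holderConjugate_one_div (a := 1 / 2) (b := 1 / 2) (by norm_num) (by norm_num)
      (by norm_num)
    norm_num at this
    exact this
  have hmE : AEMeasurable (fun s => mt s * E s ^ (1 / 2 : ℝ)) (volume.restrict (Ioo 0 t)) :=
    hmtm.mul (hEm.pow_const _)
  have hCS' : ∫⁻ s in Ioo 0 t, mt s * E s ^ (1 / 2 : ℝ) * G s ^ (1 / 2 : ℝ) ≤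
      (N * J₂) ^ (1 / 2 : ℝ) * (N' * Γ) ^ (1 / 2 : ℝ) := by
    have h := ENNReal.lintegral_mul_le_Lp_mul_Lq (volume.restrict (Ioo 0 t)) hpq2 hmE (hGm.pow_const (1 / 2 : ℝ))
    simp only [Pi.mul_apply] at h
    have e1 : ∀ s, (mt s * E s ^ (1 / 2 : ℝ)) ^ (2 : ℝ) = mt s ^ (2 : ℝ) * E s := fun s => by
      rw [ENNReal.mul_rpow_of_nonneg _ _ (by norm_num), ← ENNReal.rpow_mul]; norm_num
    have e2 : ∀ s, (G s ^ (1 / 2 : ℝ)) ^ (2 : ℝ) = G s := fun s => by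
      rw [← ENNReal.rpow_mul]; norm_num
    simp only [e1, e2] at h
    refine h.trans ?_
    gcongr
  calc ∫⁻ z in Ioo 0 t ×ˢ ball x₀ R, ‖u₁ z.1 z.2‖ₑ *
        (ENNReal.ofReal (Real.sqrt (frobeniusNormSq (G₁ z.1 z.2 - G₂ z.1 z.2))) * ‖u₁ z.1 z.2 - u₂ z.1 z.2‖ₑ)
      = ∫⁻ s in Ioo 0 t, ∫⁻ x in ball x₀ R, ‖u₁ s x‖ₑ *
          (ENNReal.ofReal (Real.sqrt (frobeniusNormSq (G₁ s x - G₂ s x))) * ‖u₁ s x - u₂ s x‖ₑ) := hT₂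
    _ ≤ ∫⁻ s in Ioo 0 t, (mt s * E s ^ (1 / 2 : ℝ) * G s ^ (1 / 2 : ℝ) +
          ENNReal.ofReal ε * CS * ((E s + G s) + G s)) :=
        lintegral_mono_ae (hgood.mono fun s hs => hs.trans (hsplit s))
    _ = (∫⁻ s in Ioo 0 t, mt s * E s ^ (1 / 2 : ℝ) * G s ^ (1 / 2 : ℝ)) +
          ∫⁻ s in Ioo 0 t, ENNReal.ofReal ε * CS * ((E s + G s) + G s) :=
        lintegral_add_left' (hmE.mul (hGm.pow_const _)) _
    _ ≤ (N * J₂) ^ (1 / 2 : ℝ) * (N' * Γ) ^ (1 / 2 : ℝ) +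
          ENNReal.ofReal ε * CS * ((N * I + N' * Γ) + N' * Γ) := by
        have hm2 : AEMeasurable (fun s => E s + G s) (volume.restrict (Ioo 0 t)) := hEm.add hGm
        have hm3 : AEMeasurable (fun s => (E s + G s) + G s) (volume.restrict (Ioo 0 t)) := hm2.add hGm
        rw [lintegral_const_mul'' _ hm3, lintegral_add_left' hm2, lintegral_add_left' hEm]
        gcongr
    _ = (N : ℝ≥0∞) ^ (1 / 2 : ℝ) * (N' : ℝ≥0∞) ^ (1 / 2 : ℝ) * (Γ ^ (1 / 2 : ℝ) * J₂ ^ (1 / 2 : ℝ)) +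
          ENNReal.ofReal ε * CS * ((N * I + N' * Γ) + N' * Γ) := by
        rw [ENNReal.mul_rpow_of_nonneg _ _ (by norm_num : (0 : ℝ) ≤ 1 / 2),
          ENNReal.mul_rpow_of_nonneg _ _ (by norm_num : (0 : ℝ) ≤ 1 / 2)]
        ring
    _ ≤ ((N + 1) * (N' + 1) : ℝ≥0∞) * (Γ ^ (1 / 2 : ℝ) * J₂ ^ (1 / 2 : ℝ)) +
          ENNReal.ofReal ε * CS * ((N * I + N' * Γ) + N' * Γ) := by
        gcongr
        · exact rpow_half_le_add_one _
        · exact rpow_half_le_add_one _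
    _ ≤ ((N + 1) * (N' + 1) + CS * (N + 2 * N') : ℝ≥0) *
          (Γ ^ (1 / 2 : ℝ) * J₂ ^ (1 / 2 : ℝ) + ENNReal.ofReal ε * (Γ + I)) := by
        push_cast
        set K : ℝ≥0∞ := ((N : ℝ≥0∞) + 1) * (N' + 1) + CS * (N + 2 * N') with hK
        have h1 : ((N : ℝ≥0∞) + 1) * (N' + 1) * (Γ ^ (1 / 2 : ℝ) * J₂ ^ (1 / 2 : ℝ)) ≤
            K * (Γ ^ (1 / 2 : ℝ) * J₂ ^ (1 / 2 : ℝ)) := mul_le_mul_left le_self_add _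
        have h2 : ENNReal.ofReal ε * CS * ((N * I + N' * Γ) + N' * Γ) ≤ K * (ENNReal.ofReal ε * (Γ + I)) := by
          calc ENNReal.ofReal ε * CS * ((N * I + N' * Γ) + N' * Γ)
              = ENNReal.ofReal ε * (CS * N * I + CS * (2 * N') * Γ) := by ring
            _ ≤ ENNReal.ofReal ε * (CS * (N + 2 * N') * I + CS * (N + 2 * N') * Γ) := by
                gcongr
                · exact le_self_add
                · exact le_add_self
            _ = CS * (N + 2 * N') * (ENNReal.ofReal ε * (Γ + I)) := by ring
            _ ≤ K * (ENNReal.ofReal ε * (Γ + I)) := mul_le_mul_left le_add_self _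
        calc ((N : ℝ≥0∞) + 1) * (N' + 1) * (Γ ^ (1 / 2 : ℝ) * J₂ ^ (1 / 2 : ℝ)) +
              ENNReal.ofReal ε * CS * ((N * I + N' * Γ) + N' * Γ)
            ≤ K * (Γ ^ (1 / 2 : ℝ) * J₂ ^ (1 / 2 : ℝ)) + K * (ENNReal.ofReal ε * (Γ + I)) := add_le_add h1 h2
          _ = K * (Γ ^ (1 / 2 : ℝ) * J₂ ^ (1 / 2 : ℝ) + ENNReal.ofReal ε * (Γ + I)) := by ring

end LemarieRieusset2016

/-! ## The three transport estimates -/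

/-- **The transport estimates of Lemarié-Rieusset 2016, p. 517, proved**: for every test
function `φ` there is `C = C(φ)` such that in every weak–strong setting, for every centre `x₀`
and `t ∈ (0,T]`, with `w = u₁ - u₂`, `α² = ulocEnergy`, `γ² = ulocGradEnergyOn`,
"`∫₀ᵗ∫|(w·∇φ)(u₁·w)| ≤ C(∫₀ᵗ m α² + ε(γ² + ∫₀ᵗα²))`", "`∫₀ᵗ∫|(u₁·∇φ)||w|²/2 ≤ C(∫₀ᵗ m α² +
ε(γ² + ∫₀ᵗα²))`", "`∫₀ᵗ∫φ|u₁·(w·∇w)| ≤ C(γ(∫₀ᵗ m²α²)^{1/2} + ε(γ² + ∫₀ᵗα²))`" (the printed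
"`≤ C∫₀ᵗ‖u₃‖_∞α² + C‖u₄‖_{L^∞𝒱̄¹}γ(γ² + ∫₀ᵗα²)^{1/2}`" etc., with `‖u₃(s)‖_∞ ≤ m(s)`,
`‖u₄‖ ≤ ε` in `L³`, and `γ(γ² + ∫α²)^{1/2} ≤ γ² + ∫α²`): the bump factors are bounded by `B(φ)`
and supported in `B(x₀, R(φ))` (`exists_testFunction_translate_bounds`), which reduces the three
integrals to the transport and stretching cylinders (`exists_cylinder_transport_bound`,
`exists_cylinder_stretching_bound`). This is hypothesis `hN` of
`local_leray_difference_rhs_estimate_of` (`LocalLerayDifferenceRHS.lean`).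
[cite: LemarieRieusset2016, Thm. 14.7, proof (file p. 517, fourth, sixth and seventh estimates)] -/
theorem local_leray_difference_transport_estimates :
    ∀ φ : (EuclideanSpace ℝ (Fin 3)) → ℝ, FunctionSpaces.IsTestFunctionOn (⊤ : Opens (EuclideanSpace ℝ (Fin 3))) φ → ∃ C : ℝ, 0 < C ∧
      ∀ {ν T : ℝ} {u₀ : (EuclideanSpace ℝ (Fin 3)) → (EuclideanSpace ℝ (Fin 3))} {u₁ u₂ : ℝ → (EuclideanSpace ℝ (Fin 3)) → (EuclideanSpace ℝ (Fin 3))} {p₁ p₂ : ℝ → (EuclideanSpace ℝ (Fin 3)) → ℝ}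
        {u₃ u₄ : ℝ → (EuclideanSpace ℝ (Fin 3)) → (EuclideanSpace ℝ (Fin 3))} {m : ℝ → ℝ} {ε : ℝ} {G₁ G₂ : ℝ → (EuclideanSpace ℝ (Fin 3)) → (EuclideanSpace ℝ (Fin 3)) →L[ℝ] (EuclideanSpace ℝ (Fin 3))},
        LemarieRieusset2016.WeakStrongSetting ν T u₀ u₁ u₂ p₁ p₂ u₃ u₄ m ε G₁ G₂ →
        ∀ (x₀ : (EuclideanSpace ℝ (Fin 3))) (t : ℝ), t ∈ Ioc 0 T →
          (∫⁻ z in Ioo 0 t ×ˢ (univ : Set (EuclideanSpace ℝ (Fin 3))),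
              ‖⟪u₁ z.1 z.2, u₁ z.1 z.2 - u₂ z.1 z.2⟫‖ₑ *
                ‖⟪u₁ z.1 z.2 - u₂ z.1 z.2, gradient (fun x => φ (x - x₀)) z.2⟫‖ₑ) ≤
            ENNReal.ofReal C *
              ((∫⁻ s in Ioo 0 t, ENNReal.ofReal (m s) * ulocEnergy (u₁ s - u₂ s)) +
                ENNReal.ofReal ε *
                  (ulocGradEnergyOn t (G₁ - G₂) + ∫⁻ s in Ioo 0 t, ulocEnergy (u₁ s - u₂ s))) ∧
          (∫⁻ z in Ioo 0 t ×ˢ (univ : Set (EuclideanSpace ℝ (Fin 3))),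
              2⁻¹ * ‖u₁ z.1 z.2 - u₂ z.1 z.2‖ₑ ^ 2 *
                ‖⟪u₁ z.1 z.2, gradient (fun x => φ (x - x₀)) z.2⟫‖ₑ) ≤
            ENNReal.ofReal C *
              ((∫⁻ s in Ioo 0 t, ENNReal.ofReal (m s) * ulocEnergy (u₁ s - u₂ s)) +
                ENNReal.ofReal ε *
                  (ulocGradEnergyOn t (G₁ - G₂) + ∫⁻ s in Ioo 0 t, ulocEnergy (u₁ s - u₂ s))) ∧
          (∫⁻ z in Ioo 0 t ×ˢ (univ : Set (EuclideanSpace ℝ (Fin 3))),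
              ENNReal.ofReal (φ (z.2 - x₀)) *
                ‖⟪u₁ z.1 z.2, (G₁ z.1 z.2 - G₂ z.1 z.2) (u₁ z.1 z.2 - u₂ z.1 z.2)⟫‖ₑ) ≤
            ENNReal.ofReal C *
              (ulocGradEnergyOn t (G₁ - G₂) ^ (1 / 2 : ℝ) *
                  (∫⁻ s in Ioo 0 t, ENNReal.ofReal (m s ^ 2) * ulocEnergy (u₁ s - u₂ s)) ^ (1 / 2 : ℝ) +
                ENNReal.ofReal ε *
                  (ulocGradEnergyOn t (G₁ - G₂) + ∫⁻ s in Ioo 0 t, ulocEnergy (u₁ s - u₂ s))) := by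
  intro φ hφ
  obtain ⟨R, B, hR, hB, hbd⟩ := exists_testFunction_translate_bounds hφ
  obtain ⟨C₁, hC₁⟩ := LemarieRieusset2016.exists_cylinder_transport_bound R
  obtain ⟨C₂, hC₂⟩ := LemarieRieusset2016.exists_cylinder_stretching_bound R
  refine ⟨(B + 1) * ((C₁ : ℝ) + C₂ + 1), by positivity, ?_⟩
  intro ν T u₀ u₁ u₂ p₁ p₂ u₃ u₄ m ε G₁ G₂ hS x₀ t ht
  have hmeas : MeasurableSet (Ioo (0 : ℝ) t ×ˢ ball x₀ R) := measurableSet_Ioo.prod measurableSet_ball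
  have hstrip : MeasurableSet (Ioo (0 : ℝ) t ×ˢ (univ : Set (EuclideanSpace ℝ (Fin 3)))) :=
    measurableSet_Ioo.prod MeasurableSet.univ
  -- constants
  have hK₁ : ENNReal.ofReal B * (C₁ : ℝ≥0∞) ≤ ENNReal.ofReal ((B + 1) * ((C₁ : ℝ) + C₂ + 1)) := by
    rw [ENNReal.ofReal_mul (by linarith)]
    refine mul_le_mul' (ENNReal.ofReal_le_ofReal (by linarith)) ?_
    rw [← ENNReal.ofReal_coe_nnreal]
    exact ENNReal.ofReal_le_ofReal (by have := C₂.coe_nonneg; linarith)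
  have hK₂ : ENNReal.ofReal B * (C₂ : ℝ≥0∞) ≤ ENNReal.ofReal ((B + 1) * ((C₁ : ℝ) + C₂ + 1)) := by
    rw [ENNReal.ofReal_mul (by linarith)]
    refine mul_le_mul' (ENNReal.ofReal_le_ofReal (by linarith)) ?_
    rw [← ENNReal.ofReal_coe_nnreal]
    exact ENNReal.ofReal_le_ofReal (by have := C₁.coe_nonneg; linarith)
  -- elementary pointwise inequalities
  have hinner : ∀ a b : EuclideanSpace ℝ (Fin 3), ‖⟪a, b⟫‖ₑ ≤ ‖a‖ₑ * ‖b‖ₑ := fun a b => by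
    rw [Real.enorm_eq_ofReal_abs, ← ofReal_norm, ← ofReal_norm, ← ENNReal.ofReal_mul (norm_nonneg _)]
    exact ENNReal.ofReal_le_ofReal (abs_real_inner_le_norm _ _)
  have hgradB : ∀ (a : EuclideanSpace ℝ (Fin 3)) (x : EuclideanSpace ℝ (Fin 3)),
      ‖⟪a, gradient (fun y => φ (y - x₀)) x⟫‖ₑ ≤ ‖a‖ₑ * ENNReal.ofReal B := fun a x => by
    rw [Real.enorm_eq_ofReal_abs, ← ofReal_norm, ← ENNReal.ofReal_mul (norm_nonneg _)]
    refine ENNReal.ofReal_le_ofReal ((abs_real_inner_le_norm _ _).trans ?_)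
    exact mul_le_mul_of_nonneg_left (hbd x₀ x).2.1 (norm_nonneg _)
  -- the reduction of a strip integral to the cylinder
  have hred : ∀ (F H : ℝ × EuclideanSpace ℝ (Fin 3) → ℝ≥0∞),
      (∀ z ∈ Ioo (0 : ℝ) t ×ˢ (univ : Set (EuclideanSpace ℝ (Fin 3))),
        F z ≤ (Ioo (0 : ℝ) t ×ˢ ball x₀ R).indicator (fun z => ENNReal.ofReal B * H z) z) →
      ∫⁻ z in Ioo 0 t ×ˢ (univ : Set (EuclideanSpace ℝ (Fin 3))), F z ≤
        ENNReal.ofReal B * ∫⁻ z in Ioo 0 t ×ˢ ball x₀ R, H z := fun F H hFH =>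
    calc ∫⁻ z in Ioo 0 t ×ˢ (univ : Set (EuclideanSpace ℝ (Fin 3))), F z
        ≤ ∫⁻ z in Ioo 0 t ×ˢ (univ : Set (EuclideanSpace ℝ (Fin 3))),
            (Ioo (0 : ℝ) t ×ˢ ball x₀ R).indicator (fun z => ENNReal.ofReal B * H z) z :=
          setLIntegral_mono' hstrip hFH
      _ = ∫⁻ z in Ioo 0 t ×ˢ ball x₀ R, ENNReal.ofReal B * H z := by
          rw [lintegral_indicator hmeas, Measure.restrict_restrict hmeas,
            inter_eq_left.2 (prod_mono Subset.rfl (subset_univ _))]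
      _ = ENNReal.ofReal B * ∫⁻ z in Ioo 0 t ×ˢ ball x₀ R, H z := lintegral_const_mul' _ _ ENNReal.ofReal_ne_top
  have hT := hC₁ hS x₀ t ht
  have hS' := hC₂ hS x₀ t ht
  refine ⟨?_, ?_, ?_⟩
  · -- `∫|(u₁·w)(w·∇φ)| ≤ B ∫_{cyl} |u₁||w|²`
    refine (hred _ (fun z => ‖u₁ z.1 z.2‖ₑ * ‖u₁ z.1 z.2 - u₂ z.1 z.2‖ₑ ^ 2) fun z hz => ?_).trans
      ((mul_le_mul_right hT _).trans ?_)
    · by_cases hzR : z.2 ∈ ball x₀ R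
      · rw [indicator_of_mem (show z ∈ Ioo (0 : ℝ) t ×ˢ ball x₀ R from ⟨hz.1, hzR⟩)]
        calc ‖⟪u₁ z.1 z.2, u₁ z.1 z.2 - u₂ z.1 z.2⟫‖ₑ *
              ‖⟪u₁ z.1 z.2 - u₂ z.1 z.2, gradient (fun x => φ (x - x₀)) z.2⟫‖ₑ
            ≤ (‖u₁ z.1 z.2‖ₑ * ‖u₁ z.1 z.2 - u₂ z.1 z.2‖ₑ) * (‖u₁ z.1 z.2 - u₂ z.1 z.2‖ₑ * ENNReal.ofReal B) :=
              mul_le_mul' (hinner _ _) (hgradB _ _)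
          _ = ENNReal.ofReal B * (‖u₁ z.1 z.2‖ₑ * ‖u₁ z.1 z.2 - u₂ z.1 z.2‖ₑ ^ 2) := by ring
      · have h0 : gradient (fun x => φ (x - x₀)) z.2 = 0 := ((hbd x₀ z.2).2.2.2 hzR).2.1
        rw [h0, inner_zero_right, enorm_zero, mul_zero]
        exact bot_le
    · rw [← mul_assoc]
      exact mul_le_mul_left hK₁ _
  · -- `∫|w|²|u₁·∇φ|/2 ≤ B ∫_{cyl} |u₁||w|²`
    refine (hred _ (fun z => ‖u₁ z.1 z.2‖ₑ * ‖u₁ z.1 z.2 - u₂ z.1 z.2‖ₑ ^ 2) fun z hz => ?_).trans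
      ((mul_le_mul_right hT _).trans ?_)
    · by_cases hzR : z.2 ∈ ball x₀ R
      · rw [indicator_of_mem (show z ∈ Ioo (0 : ℝ) t ×ˢ ball x₀ R from ⟨hz.1, hzR⟩)]
        calc 2⁻¹ * ‖u₁ z.1 z.2 - u₂ z.1 z.2‖ₑ ^ 2 * ‖⟪u₁ z.1 z.2, gradient (fun x => φ (x - x₀)) z.2⟫‖ₑ
            ≤ 1 * ‖u₁ z.1 z.2 - u₂ z.1 z.2‖ₑ ^ 2 * (‖u₁ z.1 z.2‖ₑ * ENNReal.ofReal B) := by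
              gcongr
              · exact ENNReal.inv_le_one.2 one_le_two
              · exact hgradB _ _
          _ = ENNReal.ofReal B * (‖u₁ z.1 z.2‖ₑ * ‖u₁ z.1 z.2 - u₂ z.1 z.2‖ₑ ^ 2) := by ring
      · have h0 : gradient (fun x => φ (x - x₀)) z.2 = 0 := ((hbd x₀ z.2).2.2.2 hzR).2.1
        rw [h0, inner_zero_right, enorm_zero, mul_zero]
        exact bot_le
    · rw [← mul_assoc]
      exact mul_le_mul_left hK₁ _
  · -- `∫φ|u₁·(∇w w)| ≤ B ∫_{cyl} |u₁||∇w|_F|w|`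
    refine (hred _ (fun z => ‖u₁ z.1 z.2‖ₑ *
        (ENNReal.ofReal (Real.sqrt (frobeniusNormSq (G₁ z.1 z.2 - G₂ z.1 z.2))) * ‖u₁ z.1 z.2 - u₂ z.1 z.2‖ₑ))
      fun z hz => ?_).trans ((mul_le_mul_right hS' _).trans ?_)
    · by_cases hzR : z.2 ∈ ball x₀ R
      · rw [indicator_of_mem (show z ∈ Ioo (0 : ℝ) t ×ˢ ball x₀ R from ⟨hz.1, hzR⟩)]
        have hφB : ENNReal.ofReal (φ (z.2 - x₀)) ≤ ENNReal.ofReal B :=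
          ENNReal.ofReal_le_ofReal ((le_abs_self _).trans (hbd x₀ z.2).1)
        have hLv : ‖(G₁ z.1 z.2 - G₂ z.1 z.2) (u₁ z.1 z.2 - u₂ z.1 z.2)‖ₑ ≤
            ENNReal.ofReal (Real.sqrt (frobeniusNormSq (G₁ z.1 z.2 - G₂ z.1 z.2))) * ‖u₁ z.1 z.2 - u₂ z.1 z.2‖ₑ := by
          rw [← ofReal_norm, ← ofReal_norm, ← ENNReal.ofReal_mul (Real.sqrt_nonneg _)]
          exact ENNReal.ofReal_le_ofReal (norm_apply_le_sqrt_frobeniusNormSq_mul _ _)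
        calc ENNReal.ofReal (φ (z.2 - x₀)) *
              ‖⟪u₁ z.1 z.2, (G₁ z.1 z.2 - G₂ z.1 z.2) (u₁ z.1 z.2 - u₂ z.1 z.2)⟫‖ₑ
            ≤ ENNReal.ofReal B * (‖u₁ z.1 z.2‖ₑ * ‖(G₁ z.1 z.2 - G₂ z.1 z.2) (u₁ z.1 z.2 - u₂ z.1 z.2)‖ₑ) :=
              mul_le_mul' hφB (hinner _ _)
          _ ≤ ENNReal.ofReal B * (‖u₁ z.1 z.2‖ₑ *
              (ENNReal.ofReal (Real.sqrt (frobeniusNormSq (G₁ z.1 z.2 - G₂ z.1 z.2))) *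
                ‖u₁ z.1 z.2 - u₂ z.1 z.2‖ₑ)) := by gcongr
      · have h0 : φ (z.2 - x₀) = 0 := ((hbd x₀ z.2).2.2.2 hzR).1
        rw [h0, ENNReal.ofReal_zero, zero_mul]
        exact bot_le
    · rw [← mul_assoc]
      exact mul_le_mul_left hK₂ _


/-! ## U₁ and U from the two deep inputs -/

/-- **U₁ from the tested energy inequality and the pressure estimates.** The composition of
`local_leray_difference_energy_estimate_of_pressure_transport` (`LocalLerayDifferenceRHS.lean`)
with the proved transport estimates: the local energy estimate **U₁**
(`local_leray_difference_energy_estimate`, Lemarié-Rieusset 2016, p. 518) follows from part 1 of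
the printed proof (the tested local energy inequality for `w = u₁ - u₂`, pp. 515–516,
hypothesis `hA`) and the pressure estimates (pp. 516–517, hypothesis `hP`) alone.
[cite: LemarieRieusset2016, Thm. 14.7, proof (file pp. 515–518)] -/
theorem local_leray_difference_energy_estimate_of_energyIneq_pressure
    (hA : ∀ {ν T : ℝ} {u₀ : (EuclideanSpace ℝ (Fin 3)) → (EuclideanSpace ℝ (Fin 3))} {u₁ u₂ : ℝ → (EuclideanSpace ℝ (Fin 3)) → (EuclideanSpace ℝ (Fin 3))} {p₁ p₂ : ℝ → (EuclideanSpace ℝ (Fin 3)) → ℝ}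
      {u₃ u₄ : ℝ → (EuclideanSpace ℝ (Fin 3)) → (EuclideanSpace ℝ (Fin 3))} {m : ℝ → ℝ} {ε : ℝ} {G₁ G₂ : ℝ → (EuclideanSpace ℝ (Fin 3)) → (EuclideanSpace ℝ (Fin 3)) →L[ℝ] (EuclideanSpace ℝ (Fin 3))},
      LemarieRieusset2016.WeakStrongSetting ν T u₀ u₁ u₂ p₁ p₂ u₃ u₄ m ε G₁ G₂ →
      ∀ᵐ t ∂(volume.restrict (Ioo 0 T)), ∀ φ : (EuclideanSpace ℝ (Fin 3)) → ℝ,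
        FunctionSpaces.IsTestFunctionOn (⊤ : Opens (EuclideanSpace ℝ (Fin 3))) φ → (∀ x, 0 ≤ φ x) →
        2⁻¹ * weightedEnergy φ (u₁ t - u₂ t) +
            ENNReal.ofReal ν * weightedGradEnergyOn t φ (G₁ - G₂) ≤
          differenceEnergyRHS ν t u₁ u₂ p₁ p₂ G₁ G₂ φ)
    (hP : ∀ φ : (EuclideanSpace ℝ (Fin 3)) → ℝ, FunctionSpaces.IsTestFunctionOn (⊤ : Opens (EuclideanSpace ℝ (Fin 3))) φ → ∃ C : ℝ, 0 < C ∧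
        ∀ {ν T : ℝ} {u₀ : (EuclideanSpace ℝ (Fin 3)) → (EuclideanSpace ℝ (Fin 3))} {u₁ u₂ : ℝ → (EuclideanSpace ℝ (Fin 3)) → (EuclideanSpace ℝ (Fin 3))} {p₁ p₂ : ℝ → (EuclideanSpace ℝ (Fin 3)) → ℝ}
          {u₃ u₄ : ℝ → (EuclideanSpace ℝ (Fin 3)) → (EuclideanSpace ℝ (Fin 3))} {m : ℝ → ℝ} {ε : ℝ} {G₁ G₂ : ℝ → (EuclideanSpace ℝ (Fin 3)) → (EuclideanSpace ℝ (Fin 3)) →L[ℝ] (EuclideanSpace ℝ (Fin 3))},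
          LemarieRieusset2016.WeakStrongSetting ν T u₀ u₁ u₂ p₁ p₂ u₃ u₄ m ε G₁ G₂ →
          ∀ (x₀ : (EuclideanSpace ℝ (Fin 3))) (t : ℝ), t ∈ Ioc 0 T →
            ‖∫ z in Ioo 0 t ×ˢ (univ : Set (EuclideanSpace ℝ (Fin 3))),
                (p₁ z.1 z.2 - p₂ z.1 z.2) * ⟪u₁ z.1 z.2 - u₂ z.1 z.2, gradient (fun x => φ (x - x₀)) z.2⟫‖ₑ ≤
              ENNReal.ofReal C *
                  (ulocCubicOn t (u₁ - u₂) +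
                    ∫⁻ s in Ioo 0 t, ENNReal.ofReal (m s) * ulocEnergy (u₁ s - u₂ s)) +
                ENNReal.ofReal C * ENNReal.ofReal ε *
                  (ulocGradEnergyOn t (G₁ - G₂) + ∫⁻ s in Ioo 0 t, ulocEnergy (u₁ s - u₂ s))) :
    local_leray_difference_energy_estimate :=
  local_leray_difference_energy_estimate_of_pressure_transport hA hP
    local_leray_difference_transport_estimates

/-- **U from the tested energy inequality and the pressure estimates**: weak–strong uniqueness
for local Leray solutions (`local_leray_weak_strong_uniqueness`, Lemarié-Rieusset 2016,
Thm. 14.7) follows from the two deep inputs of its printed proof — the tested local energy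
inequality for the difference of a local Leray solution and a regular one (pp. 515–516) and the
local pressure estimates (pp. 516–517; Kang–Miura–Tsai 2021, Lemma 3.4) — everything else
(interpolation, transport estimates, Young, supremum over the bumps, Grönwall/continuity
argument) being proved in the tree (`local_leray_weak_strong_uniqueness_of`,
`local_leray_difference_energy_estimate_of`, `local_leray_difference_rhs_estimate_of`,
`local_leray_difference_transport_estimates`).
[cite: LemarieRieusset2016, Thm. 14.7, proof (file pp. 514–518)] -/
theorem local_leray_weak_strong_uniqueness_of_energyIneq_pressure
    (hA : ∀ {ν T : ℝ} {u₀ : (EuclideanSpace ℝ (Fin 3)) → (EuclideanSpace ℝ (Fin 3))} {u₁ u₂ : ℝ → (EuclideanSpace ℝ (Fin 3)) → (EuclideanSpace ℝ (Fin 3))} {p₁ p₂ : ℝ → (EuclideanSpace ℝ (Fin 3)) → ℝ}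
      {u₃ u₄ : ℝ → (EuclideanSpace ℝ (Fin 3)) → (EuclideanSpace ℝ (Fin 3))} {m : ℝ → ℝ} {ε : ℝ} {G₁ G₂ : ℝ → (EuclideanSpace ℝ (Fin 3)) → (EuclideanSpace ℝ (Fin 3)) →L[ℝ] (EuclideanSpace ℝ (Fin 3))},
      LemarieRieusset2016.WeakStrongSetting ν T u₀ u₁ u₂ p₁ p₂ u₃ u₄ m ε G₁ G₂ →
      ∀ᵐ t ∂(volume.restrict (Ioo 0 T)), ∀ φ : (EuclideanSpace ℝ (Fin 3)) → ℝ,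
        FunctionSpaces.IsTestFunctionOn (⊤ : Opens (EuclideanSpace ℝ (Fin 3))) φ → (∀ x, 0 ≤ φ x) →
        2⁻¹ * weightedEnergy φ (u₁ t - u₂ t) +
            ENNReal.ofReal ν * weightedGradEnergyOn t φ (G₁ - G₂) ≤
          differenceEnergyRHS ν t u₁ u₂ p₁ p₂ G₁ G₂ φ)
    (hP : ∀ φ : (EuclideanSpace ℝ (Fin 3)) → ℝ, FunctionSpaces.IsTestFunctionOn (⊤ : Opens (EuclideanSpace ℝ (Fin 3))) φ → ∃ C : ℝ, 0 < C ∧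
        ∀ {ν T : ℝ} {u₀ : (EuclideanSpace ℝ (Fin 3)) → (EuclideanSpace ℝ (Fin 3))} {u₁ u₂ : ℝ → (EuclideanSpace ℝ (Fin 3)) → (EuclideanSpace ℝ (Fin 3))} {p₁ p₂ : ℝ → (EuclideanSpace ℝ (Fin 3)) → ℝ}
          {u₃ u₄ : ℝ → (EuclideanSpace ℝ (Fin 3)) → (EuclideanSpace ℝ (Fin 3))} {m : ℝ → ℝ} {ε : ℝ} {G₁ G₂ : ℝ → (EuclideanSpace ℝ (Fin 3)) → (EuclideanSpace ℝ (Fin 3)) →L[ℝ] (EuclideanSpace ℝ (Fin 3))},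
          LemarieRieusset2016.WeakStrongSetting ν T u₀ u₁ u₂ p₁ p₂ u₃ u₄ m ε G₁ G₂ →
          ∀ (x₀ : (EuclideanSpace ℝ (Fin 3))) (t : ℝ), t ∈ Ioc 0 T →
            ‖∫ z in Ioo 0 t ×ˢ (univ : Set (EuclideanSpace ℝ (Fin 3))),
                (p₁ z.1 z.2 - p₂ z.1 z.2) * ⟪u₁ z.1 z.2 - u₂ z.1 z.2, gradient (fun x => φ (x - x₀)) z.2⟫‖ₑ ≤
              ENNReal.ofReal C *
                  (ulocCubicOn t (u₁ - u₂) +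
                    ∫⁻ s in Ioo 0 t, ENNReal.ofReal (m s) * ulocEnergy (u₁ s - u₂ s)) +
                ENNReal.ofReal C * ENNReal.ofReal ε *
                  (ulocGradEnergyOn t (G₁ - G₂) + ∫⁻ s in Ioo 0 t, ulocEnergy (u₁ s - u₂ s))) :
    local_leray_weak_strong_uniqueness :=
  local_leray_weak_strong_uniqueness_of
    (local_leray_difference_energy_estimate_of_energyIneq_pressure hA hP)

end Literature.Analysis.FluidPDE
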